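import Mathlib
import Summits.CriticalPhenomena.Ising3DConformalLimit.Theses.GaussianScaleMixture
import Literature.MathematicalPhysics.QuantumFieldTheory.LatticeMirrorNormals
import Literature.MathematicalPhysics.QuantumFieldTheory.MirrorRPKernel
import Literature.Analysis.SpecialFunctions.IsStieltjesFunction

/-!
# Disproof work file — crux `GSMRigidity` (stmt-CriticalPhenomena-8366), standing disprover

Crux (route GaussianScaleMixture, item r3 = card K2 "DQR"): a continuous positive kernel `K` on
`ℝ³∖{0}`, homogeneous of degree `-2Δ` (`1/2 ≤ Δ ≤ 1`), invariant and reflection positive (finite point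
configurations in the open half-space) for the nine `B₃` mirror normals `eᵢ, eᵢ ± eⱼ`, which is
moreover a GAUSSIAN SCALE MIXTURE off the origin (`K x = ∫ exp(-Σ sᵢ xᵢ²) dν(s)`, `ν` on the closed
octant), is `O(3)`-invariant.

## VERDICT OF CYCLE 1 (2026-08-16): NO KILL — the crux is, to all appearances, TRUE, and this file
## records a complete paper proof (F3) whose last step is certified here in Lean (`jump_positivity`).
## VERDICT OF CYCLE 2 (2026-08-16, seat g2): NO KILL — F3 AUDITED STEP BY STEP AND FOUND CORRECT (F8);
## the only place a kill could still hide (a gap in F3 / a Lean-vs-paper mismatch) is closed. New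
## checked content: every finite sum of inverse quadrics is a GSM (`quadricSum_isGSM`); the planner's
## cheapest-falsifier family is certified non-swap-RP at ε = 1/2 (3 points) and ε = 1/5 (7 points,
## binomial sixth difference) with the exact law "minimal certificate order ≈ 1.2/ε" (F10); closed
## form of the swap time function and its first zero u* ≈ 2.39/(ε k_v) (F10); simplifications F9.
## VERDICT OF CYCLE 3 (2026-08-16, seat g3): NO KILL — and NO STUB OF ANY OF THE THREE REGISTERED LINES
## IS FALSE (F11: 15 stub signatures read symbol by symbol; `Lines/{momentum-one-amplitude,
## swap-pencil-branch-arc, tilted-lightcone-jump-positivity}.lean`). New certified content (F14): two stub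
## hypotheses proved NECESSARY (`stieltjesHalfPlane_false_at_beta_half`: `1 ≤ β`, i.e. `Δ ≤ 1`, in S4 of
## the momentum line; `oneAmplitudeMomentum_false_without_exchangeability`: exchangeability in its S5), the
## x-side lever's termwise SIGN (`im_cpow_neg_neg`/`_pos`), the identity theorem from the positive reals
## (`eqOn_rhp_of_eqOn_ofReal`), the MASSIVE circle lemma pinning where homogeneity enters F3 (F12,
## `swapSlice_factor_massive`; `GSMRigidityWithoutHomogeneity` stated, status open), and the exponent-0
## emptiness of both one-variable levers (`not_sliceRigidity_zero`, `not_sliceNoMassX_zero`).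
## ADDENDUM (same cycle): the x-side lever ITSELF is now PROVED here for `0 < Δ < 1` —
## `sliceNoMassX_of_lt_one` (= stub `stub_sliceNoMass_lt_one` of the line tilted-lightcone-jump-positivity,
## verbatim restatement; sorry-free, axioms propext/Classical.choice/Quot.sound): learnings from the failed
## disproof (one circle, one sign) turned into the proof of the hardest x-side stub.

Everything below is either PROVED IN THIS FILE (Lean, sorry-free) or a paper / numerical finding
recorded in this docblock (scripts in the disprover's folder `num/`, pure python, exact rational
arithmetic where it matters).

## Lean content (all sorry-free)

* `GSMRigidityWithoutRP`, `gsmRigidity_false_without_RP`, `withoutRP_imp_crux` — LOAD-BEARING: the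
  crux with the reflection-positivity conjunct dropped (all nine mirror INVARIANCES, continuity,
  positivity, homogeneity, the window and the GSM representation kept) is FALSE. Witness at `Δ = 1`:
  the exchangeable three-atom Gaussian scale mixture
  `threeAtomKernel x = Σᵢ 1/(‖x‖² + xᵢ²) = ∫ e^{-s·x²} dν(s)`, `ν = Σᵢ (r ↦ r(𝟙 + eᵢ))_* Leb|_(0,∞)`
  (`threeAtomKernel_isGSM`, an honest `MeasureTheory.Measure` on `Fin 3 → ℝ` with the integrability
  and the integral identity proved), `O_h`-invariant, continuous, positive, homogeneous of degree `-2`,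
  and anisotropic: `K e₀ = 5/2 ≠ 297/130 = K (θ_{(1,1,1)} e₀)`. Any proof must use RP.
* `threeAtomKernel_not_swapRP` — WHICH RP kills the witness: the DIAGONAL (swap) mirror `x₁ = x₂`.
  Exact 4-point certificate: points `(3,-3,0), (4,-2,0), (5,-1,0), (6,0,0)` (all with `x₁ - x₂ = 6 > 0`),
  coefficients `(5, -14, 14, -5)`: `Σ c_a c_b K(p_a - θ₁₂ p_b) = -3305/17120862 < 0` (`norm_num`).
  (On paper the three COORDINATE mirrors are RP for this `K`: each atom `(ω·x²)^{-1}` is the Riesz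
  kernel `‖A_ω x‖^{-2}` after a diagonal change of variables, Frank–Lieb 2010 Lemma 2.1 with
  `λ = 2 ≥ N - 2`; so the six diagonal mirrors carry the whole content, as for HRP2Rigidity.)
  The shape of the certificate — an alternating third difference ALONG the mirror at fixed height —
  is the finite shadow of the mechanism in F3 (transverse momentum `q ∥ e₁+e₂`, large mirror time).
* `swapSlice_factor`, `swapSlice_rho_abs_lt_one` — TOOL (the "circle lemma", F3 step 2): on the
  transverse momentum `q = k_v (e₁+e₂)/√2` (i.e. `k₃ = 0`) the swap pencil of the atom `ω` is
  `a_ω (t² - 2ρ_ω k_v t + k_v²)` with `ρ_ω = (ω₁-ω₂)/(ω₁+ω₂) ∈ (-1,1)`: ALL complex singularities of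
  ALL atoms lie on the one circle `|t| = k_v`, at the angle `θ_ω = arccos ρ_ω`.
* `arcBase_eq`, `arcBase_eq'` — TOOL (F3 step 3, the phase lemma, certified in `ℂ`):
  `(e^{iφ}-e^{iθ})(e^{iφ}-e^{-iθ}) = e^{2iφ} - 2cos θ e^{iφ} + 1 = 2(cos φ - cos θ)e^{iφ}` — the base of
  the arc jump is a negative real multiple of `e^{iφ}` for `θ < φ`, so all atoms jump with ONE phase.
* `jump_positivity`, `jump_positivity_of_frequently`, `jump_positivity_ae`,
  `measure_Ioo_eq_zero_of_jump_eq_zero` — TOOL (F3 step 4, the punchline, certified): if a measure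
  `G` on `ℝ` satisfies `∫⁻_{(0,φ)} (cos θ - cos φ)^{-p} dG(θ) = 0` for every (resp. frequently-near-`π/2`,
  resp. Lebesgue-a.e.) `φ ∈ (0, π/2)` then `G (0, π/2) = 0`.
  (Positivity of the jump integrand: no Titchmarsh / stationary phase / Phragmén–Lindelöf needed.)
* `SwapPencilAnalytic`, `SliceRigidity` — the two statements (Props, no sorry) into which F3 splits
  the crux, for planners/provers; `GSMRigidity` follows from them plus the polar form F1 (paper).
  (Cycle 2 audit: `SliceRigidity p` is TRUE AS STATED for `0 < p < 1` — the Bochner integral in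
  `SwapPencilAnalytic` is a genuine integral since `t² - 2t cos θ + 1 ≥ (t-1)² > 0`, the identity
  theorem needs `F = f` on the positive reals only, no symmetry of `G` about `π/2` is used; it is
  FALSE for `p = 0` or `p ∈ -ℕ` (entire pencils), irrelevant here; at `p = 1` it holds by F8(vii).)
* Cycle 2: `quadricSum_isGSM` — EVERY finite positive sum `Σ_t 1/(w_t·x²)` of inverse diagonal
  quadrics is a Gaussian scale mixture in the crux's sense (honest measure: `N` rays of the octant);
  `plannerKernel ε` = the route's CHEAPEST-FALSIFIER family `Σ_{σ∈S₃} 1/(ω_σ·x²)`, `ω = (1+ε,1-ε,1)`,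
  at `Δ = 1` (`plannerKernel_isGSM`, `plannerKernel_pos`, `plannerKernel_mk`);
  `plannerKernel_half_not_swapRP` (ε = 1/2: THREE points `(2,-2,0),(3,-1,0),(4,0,0)`, coefficients
  `(1,-2,1)`, form `-2764183781/1735113259880`) and `plannerKernel_fifth_not_swapRP` (ε = 1/5: SEVEN
  points `(6+a, a-6, 0)`, coefficients `(1,-6,15,-20,15,-6,1)`, form `≈ -1.7·10⁻⁸`, exact) — the
  planner's kill criterion cannot fire at these ε either, and the certificate ORDER grows like `1/ε`
  (F10). `swapSlice_factor_offplane` — no circle lemma off the plane `k_w = 0` (root product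
  `k² + k_w² τ_ω` depends on `ω`). `atom_pOne_partialFraction` — the `p = 1` (`Δ = 1/2`) endpoint is a
  Cauchy transform (F8(vii)). LANDED (cycle 2): `Theorems/GSMRigidity/Negative/SwapPencilJump.lean`
  = p74276 (circle lemma, phase lemma, jump positivity, p = 1 partial fraction; no defs) and
  `Theorems/GSMRigidity/Negative/PlannerFamily.lean` = p74552 (quadricSum_isGSM, plannerKernel and the
  two certificates); cycle 1: `Negative/ThreeAtomKernel.lean` = p73025 (accepted).

## Findings (F-list)

* F1 (structure, = route-review note of refuter 81300ae8, re-derived). Laplace uniqueness on the open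
  octant + homogeneity force `ν = r^{Δ-1} dr ⊗ Φ(dω)`, `Φ` a FINITE measure on the open simplex
  (faces are `Φ`-null by integrability at the axes, `∫ ωᵢ^{-Δ} dΦ < ∞`), and
  `K x = Γ(Δ) ∫ (ω·x²)^{-Δ} dΦ(ω)` for all `x ≠ 0`; Fourier side (tempered, `0 < 2Δ < 3`):
  `K̂(k) = c_Δ Γ(Δ) ∫ (ω₁ω₂ω₃)^{-1/2} (Σ kᵢ²/ωᵢ)^{-p} dΦ(ω)`, `p = 3/2 - Δ ∈ [1/2, 1]`, `c_Δ > 0`.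
  Coordinate mirrors: invariance automatic, RP termwise (Frank–Lieb). Anti-diagonal `eᵢ+eⱼ` ⇔ swap
  `eᵢ-eⱼ` (conjugate by the coordinate mirror `xⱼ ↦ -xⱼ`). The RP form of the crux only sees the
  swap-SYMMETRISED kernel, so neither exchangeability of `Φ` nor the invariance conjuncts are needed:
  the whole content is "swap-RP for two of the three swaps ⇒ Φ ⊂ {ω₁ = ω₂ = ω₃}".
* F2 (dictionary, as for HRP2Rigidity F1, all refuters agree). RP for the mirror `u = (x₁-x₂)/√2 = 0`
  ⇒ for a.e. transverse momentum `q = (k_v, k_w)` (along `(e₁+e₂)/√2, e₃`) and then, by continuity of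
  `K̂` off the two points `(t, q) = (±k_v, (k_v, 0))` (dominated convergence with the majorants
  `ε^{p-1}` at the vertices / `ε^{p-1/2}` at the edges of the simplex, all `Φ`-integrable because
  `∫ωᵢ^{-Δ}dΦ < ∞` and `Δ ≥ 1/2`), for ALL `q` with `k_w ≠ 0`: the pencil
  `f_q(t) = K̂(t u + q) = ∫ c_ω (a_ω t² + 2 b_ω k_v t + a_ω k_v² + k_w²/ω₃)^{-p} dΦ(ω)`,
  `a = (1/ω₁+1/ω₂)/2`, `b = (1/ω₁-1/ω₂)/2`, `c_ω = (ω₁ω₂ω₃)^{-1/2}`, is a Stieltjes function of `s = t²`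
  (Bernstein–Widder on the half-line semigroup; BCR 1984 Thm 4.6.13). The special pencil `k_w = 0` is
  reached by a Montel argument (below), so no finiteness of `K̂` on the plane `k₃ = 0` is assumed.
* F3 (THE PROOF SKETCH of GSMRigidity — why the crux resists: it is true). Fix `k_v = 1`.
  Step 1 (Taylor radius). Each pencil term has its `t`-singularities at `|t|² = 1 + τ_ω k_w² ≥ 1`
  (`τ_ω = 2ω₁ω₂/((ω₁+ω₂)ω₃)`), so `F̃_q(s) := f_q(√s)` is given on `|s| < 1` by a convergent power
  series with real coefficients (Gegenbauer expansion, coefficients bounded by `(2p)_n/n! · ∫c a^{-p}dΦ`,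
  and `∫ c_ω a_ω^{-p} dΦ < ∞` by the vertex/edge estimates). A Stieltjes function analytic in the unit
  disc has no spectral mass below `1`: `F̃_q(s) = α_q + ∫_{[1,∞)} dM_q(E)/(s+E)`, hence
  `F_q(t) := F̃_q(t²)` is analytic on `U := ℂ ∖ {iy : |y| ≥ 1}` and, for `t` in a compact of `U`,
  `|F_q(t)| ≤ C F̃_q(s₀) = C f_q(√s₀)` for any fixed `s₀ ≠ 1`, uniformly in `k_w` (monotonicity of the
  pencil terms in `k_w²`). Montel + monotone convergence `f_q ↑ f_{q₀}` (`k_w ↓ 0`) give: the special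
  pencil `f := f_{(1,0)}` (finite on `(0,1) ∪ (1,∞)`) EXTENDS ANALYTICALLY TO `U`, with `f(1) < ∞`.
  Step 2 (circle lemma, `swapSlice_factor`). At `k_w = 0`,
  `f(t) = ∫ c_ω a_ω^{-p} (t² - 2ρ_ω t + 1)^{-p} dΦ(ω) = ∫_{(0,π)} (t² - 2t cos θ + 1)^{-p} dG(θ)`,
  `G := (arccos ∘ ρ)_*(c a^{-p} Φ)` a FINITE positive measure on `(0,π)`, symmetric about `π/2` after
  symmetrisation; the singularities of the integrand are at `e^{±iθ}` ON THE UNIT CIRCLE.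
  Step 3 (jump across the arc). Let `b_θ` be the branch of `((t-e^{iθ})(t-e^{-iθ}))^{-p}` positive on
  `ℝ`, slit along the arc from `e^{±iθ}` to `±i` and then along `{iy : |y| ≥ 1}`. Then
  `Φ̃ := ∫ b_θ dG(θ)` is analytic off (arc ∪ imaginary slits), equals `f` on `(0,1) ∪ (1,∞)`, hence
  equals the analytic extension `F` of Step 1 on `U ∖ arc` — on BOTH sides of the arc. For a.e.
  `φ ∈ (0, π/2)` (those with `∫|θ-φ|^{-p}dG(θ) < ∞`, dominated convergence) the radial limits of `Φ̃`
  at `e^{iφ}` from outside and inside exist and differ by the monodromy of the atoms with `θ < φ`: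
  `Φ̃(e^{iφ}+) - Φ̃(e^{iφ}-) = (e^{2πipσ} - 1) e^{-ipχ(φ)} 2^{-p} ∫_{(0,φ)} (cos θ - cos φ)^{-p} dG(θ)`
  (`σ = ±1` fixed, `χ(φ)` a real phase; the base `(e^{iφ}-e^{iθ})(e^{iφ}-e^{-iθ}) = 2(cos φ - cos θ)e^{iφ}`
  has a `θ`-INDEPENDENT argument for `θ < φ` — checked numerically to 6 digits on atoms,
  `num/jump_atom.py`, p ∈ {0.5, 0.75, 0.9}). Continuity of `F` at `e^{iφ} ∈ U` forces the jump to
  vanish; `p ∈ [1/2, 1)` gives `e^{2πipσ} ≠ 1`. (At `p = 1`, i.e. `Δ = 1/2`, use instead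
  `∂̄ Φ̃ = π Σ residues ≠ 0` on the arc, or HRP2Rigidity's F9 leaf monotonicity.)
  Step 4 (`jump_positivity`). The integrand is POSITIVE on `(0,φ)`, so `G((0,φ)) = 0` for a.e. `φ`,
  hence `G((0,π/2)) = 0`, i.e. `Φ{ω₁ > ω₂} = 0`; symmetrically `Φ{ω₁ < ω₂} = 0`. With a second swap,
  `Φ = m δ_centre`, `K = m Γ(Δ) 3^Δ ‖x‖^{-2Δ}`, which is `O(3)`-invariant. ∎ (No use of `Δ ≤ 1` beyond
  `p > 0`; no use of `Δ ≥ 1/2` beyond `p ≤ 1` and the edge estimate; continuity, positivity and the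
  invariance conjuncts are never used — see F4.)
  This answers the planner's "destructive interference" worry and the grounder's "continuum Φ" gap
  (route-review note: atomic Φ done by slowest-decay; mechhunt note: numerics j002330): interference
  CAN smooth a continuum of branch points locally (e.g. `∫ e^{-s²}|t-s|^{-p}ds` is entire), but the
  circle lemma pins all singularities of the `k₃ = 0` pencil to ONE circle through the real point
  `t = k_v`, where inside and outside continuations must agree, and the mismatch is a positive integral.
* F4 (hypothesis mutation). RP dropped: FALSE (`gsmRigidity_false_without_RP`). GSM dropped: this is
  HRP2Rigidity (stmt-1979), open. Invariance conjuncts: UNNECESSARY (the RP form symmetrises).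
  Continuity / positivity: UNNECESSARY (automatic for GSM kernels off the origin by dominated
  convergence; `K ≡ 0` is excluded by positivity but round anyway). Window: `Δ ≥ 1/2` is needed only
  through `p ≤ 1`... in fact for `Δ < 1/2` the same argument gives `Φ = mδ` and then the round kernel is
  NOT RP (Frank–Lieb necessity), so the hypotheses are VACUOUS and the statement stays true; `Δ ≤ 1` is
  not used (`1 < Δ < 3/2` verbatim; `Δ ≥ 3/2` leaves the tempered-Fourier dictionary). Coordinate RPs:
  REDUNDANT. Of the six diagonal RPs, TWO swaps suffice (no exchangeability needed). Homogeneity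
  dropped: unclear (Yukawa mixtures exist; not pursued — not needed by the route).
* F5 (numerics, this seat; pure python, folder `num/`). (i) `swap_gram.py`/`swap_exact4.py`/`cert4.py`:
  Gram matrices `[K(p_a - θ₁₂ p_b)]` of `threeAtomKernel` on chains `p_a = (α + aδ, -α + aδ, 0)` have
  negative eigenvalues from `m = 4` on (relative size `-5·10⁻⁶` at `m = 4`, `-3·10⁻⁴` at `m = 10`,
  eigenvectors = modulated alternating profiles, as F3 predicts); the `m = 4`, `δ = α/3` instance is the
  exact certificate above. (ii) `planner_family.py` = the route's CHEAPEST FALSIFIER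
  (`k = Σ_{σ∈S₃}(ω_σ·x²)^{-Δ}`, `ω = (1+ε,1-ε,1)/3`, `Δ = 0.518`): most negative relative Gram eigenvalue
  on swap chains `m ≤ 24`: `ε = 0.9: -1.1·10⁻¹`, `ε = 0.5: -1.5·10⁻³`, `ε = 0.2: -1.1·10⁻⁷`,
  `ε = 0.05`: none resolved (predicted violation scale `k_v u ≈ 3π/ρ ≈ 190`, beyond `m = 24` chains in
  double precision); round control `ε = 0`: PSD. No certified-PSD family exists (F3), so the planner's
  kill criterion for r3 cannot fire. (iii) `jump_check.py`, `jump_atom.py`: the jump formula of F3.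
* F6 (what is left for the PROVER, honestly). (a) the 1-D dictionary F2 in Lean (Bernstein–Widder is
  not in Mathlib; BCR Thm 4.6.13 is held: book:berg1984-harmonic-analysis-semigroups); (b) Laplace
  uniqueness / polar disintegration F1; (c) the tempered Fourier transform of `(ω·x²)^{-Δ}`;
  (d) Steps 1–3 of F3 (one-variable complex analysis: Stieltjes ⇒ analytic off the cut, Montel,
  dominated radial limits, monodromy of `(t-ζ)^{-p}`). None of (a)–(d) is in doubt mathematically; all
  are heavy in Lean. A measure-free route for (d): work with the Taylor coefficients
  `γ_{2m} = ∫ C_{2m}^{(p)}(cos θ) dG` — NOT sufficient alone (smooth `G` near the centre has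
  super-polynomially small non-round corrections), so the analytic continuation is genuinely needed.
* F7 (relation to other seats). HRP2Rigidity Disproof F4 lists "positive continuous mixtures of
  quadrics (branch points off the cut do not cancel)" as dead for stmt-1979 — F3 above is the proof of
  that parenthesis (it is false as a local statement, true globally because of the circle lemma).
  Nothing here bears on HRP2Rigidity outside the GSM cone (but see F9(iv): SIGNED quadric mixtures).

## Cycle 2 (seat g2, 2026-08-16)

* F8 (ADVERSARIAL AUDIT OF F3 — the only place a kill could still hide; every step re-derived).
  (o) Polar form F1. Laplace uniqueness needs only finiteness of `L(u) = ∫e^{-s·u}dν` on the OPEN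
  octant (`e^{-s·u₀}ν` is a finite measure with exponential moments near `0`), so homogeneity of `K`
  off `0` gives `ν(λA) = λ^Δ ν(A)` (`λ > 0`), `ν{0} = 0`, `ν = r^{Δ-1}dr ⊗ Φ`; a FACE `{sᵢ = 0}` carries
  a `Δ`-homogeneous restriction, hence `ν(face) ∈ {0, ∞}`, and integrability at `x = eᵢ` (integrand
  `≡ 1` on that face) forces `0`: faces are `Φ`-null, `Φ` is finite, `Iᵢ := ∫ωᵢ^{-Δ}dΦ = K(eᵢ)/Γ(Δ) < ∞`.
  `ν` is `σ`-finite (finite on `{|s|₁ ≤ R}` by integrability at `x = (1,1,1)`). ✓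
  (i) Dictionary F2. Finite-point RP on the OPEN half-space ⇒ smeared RP for `f ∈ C_c((0,∞)) ⊗ C_c(ℝ²)`
  (Riemann sums; all arguments `p_a - θp_b` have mirror time `≥ 2 min u_a > 0`, where `K` is
  continuous). Plancherel in the transverse variables is legitimate: for `U > 0`, `y ↦ K(U,y)` is
  bounded continuous `O(|y|^{-2Δ})` and its transverse Fourier transform is the explicit locally
  integrable function F10 (singular only at `q = 0`, like `|q|^{2Δ-2}` / `log`), continuous on `q ≠ 0`.
  Localising `|ĥ_L|² → δ_{q₀}` gives: `(u,u') ↦ K̃(u+u'; q₀)` is PSD on `(0,∞)` for EVERY `q₀ ≠ 0`.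
  `K̃(·;q₀)` is continuous, bounded on `[u₀,∞)` and `→ 0` as `u → ∞` (explicit formula F10: termwise
  `e^{-ηu²r - C_q/r} ≤ e^{-2u√(ηC_q)}`, dominated; NB `y ↦ K(u,y)` is not `L¹(ℝ²)` for `Δ ≤ 1`, so
  `K̃` is the distributional transverse transform, identified with the F10 function by Fubini on the
  Gaussian representation — it blows up like `|q|^{2Δ-2}` / `log` at `q = 0` only); boundedness is
  NEEDED for Bernstein on the open half-line (`e^{+u}` is PSD on `((0,∞),+)`), and then
  `K̃(u;q) = ∫_{[0,∞)} e^{-Eu}dμ_q(E)` (BCR 1984 Ch. 4 §6), so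
  `K̂(t u + q) = ∫ 2E/(E²+t²) dμ_q = ∫ dM_q(E')/(E'+t²)` is Stieltjes in `s = t²` with `α = 0`. The RP
  form only sees the `θ`-symmetrised kernel (`K(p_b - θp_a) = K(-θ(p_a - θp_b))`, `K` even), so the
  pencil is even in `t`. ✓
  (ii) `K̂` is FINITE AND CONTINUOUS on all of `ℝ³∖{0}`, the plane `k₃ = 0` and the axes included:
  with `W(ω) := c_ω a_ω^{-p} = 2^p (ω₁ω₂)^{p-1/2} ω₃^{-1/2} (ω₁+ω₂)^{-p}` one has (WLOG `ω₁ ≤ ω₂`;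
  `(ω₁ω₂)^{p-1/2}(ω₁+ω₂)^{-p} ≤ ω₂^{p-1} ≤ ω₂^{-1/2}`; one of `ω₃`, `ω₂` is `≥ 1/3`)
  `W(ω) ≤ 2√3 (ω₁^{-Δ} + ω₂^{-Δ} + ω₃^{-Δ})`, hence `∫W dΦ ≤ 2√3 (I₁+I₂+I₃) < ∞`; and for real `t`,
  `|t| ≠ 1`: `t² - 2ρt + 1 ≥ (|t|-1)²`, so `f(t) ≤ (|t|-1)^{-2p} ∫W dΦ < ∞`. Off the plane the same
  majorant works with room to spare (vertex `(ω₂ω₃)^{(p-1)/2} ≤ min^{p-1} ≤ min^{-Δ}`, edge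
  `ω₃^{p-1/2} ≤ 1`); dominated convergence gives continuity. ✓ (So Montel is avoidable: F9(i).)
  (iii) Taylor radius. `|C_n^{(p)}(ρ)| ≤ C_n^{(p)}(1) = (2p)_n/n!` on `|ρ| ≤ 1` (`p > 0`; Szegő (7.33.1),
  DLMF 18.14.4), so `f̃(s) = Σ_m γ_{2m} s^m` converges on `|s| < 1` with `Σ|γ_{2m}||s|^m ≤ ∫W dΦ ·
  (1-√|s|)^{-2p}`. A Stieltjes function equal on `(0,1)` to a power series of radius `1` has
  `M_q([0,1)) = 0` (Stieltjes inversion; no atom at `0` since the series is bounded at `0`), hence is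
  analytic on `ℂ∖(-∞,-1]` in `s`, i.e. `F(t) = f̃(t²)` is analytic on `U = ℂ∖{iy : |y| ≥ 1}`. ✓
  (iv) Identity theorem. `Φ̃ := ∫ b_θ dG(θ)` (branches slit along the arcs `e^{±iθ} → ±i` and
  `{iy : |y| ≥ 1}`) is analytic on the open unit disc and on `{|t| > 1}∖{iy : |y| ≥ 1}` (connected);
  `F = Φ̃` on `(0,1)`, resp. `(1,∞)`, hence on both regions: ONLY the positive reals are needed (as in
  `SwapPencilAnalytic`). `F` is continuous at every `e^{iφ}`, `φ ∈ (0,π/2)`. ✓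
  (v) One phase (the load-bearing sign). Along `r ∈ [0,1]`, the continuous argument of
  `B_θ(r) = (re^{iφ} - e^{iθ})(re^{iφ} - e^{-iθ})` from `B_θ(0) = 1` ends at `φ - π` for EVERY
  `θ ∈ (0,φ)` (the factors contribute `(φ+θ)/2 + π/2 - (θ+π)` and `(φ-θ)/2 + π/2 + (θ+π) - 2π`; cleanly:
  the end value is `arg B_θ(1) + 2πm(θ)` with `B_θ(1) = 2(cos φ - cos θ)e^{iφ}` (`arcBase_eq`) of
  constant sign on `θ < φ`, and `m` is integer-valued and continuous in `θ`, hence constant). So ALL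
  atoms with `θ < φ` have inside boundary value `(2(cos θ - cos φ))^{-p} e^{-ip(φ-π)}` — one phase — and
  a common monodromy direction `σ` across their slits; atoms with `θ > φ` (and all conjugate factors)
  are continuous at `e^{iφ}` and cancel in the jump. ✓
  (vi) Dominated radial limits at a.e. `φ`: for `r ∈ [1/2, 3/2]`,
  `|re^{iφ} - e^{iθ}|² ≥ 2r(1 - cos(φ-θ)) ≥ (4r/π²)(φ-θ)²` and `|re^{iφ} - e^{-iθ}|² ≥ 2r(1 - cos(φ+θ))
  ≥ 2r(1 - cos φ) > 0` (`φ+θ ∈ (φ, φ+π)`), so `|b_θ(re^{iφ})| ≤ C_φ |φ-θ|^{-p}`, and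
  `∫|φ-θ|^{-p}dG(θ) < ∞` for Lebesgue-a.e. `φ` (Fubini, `p < 1`, `G` finite). Hence the jump formula of
  F3 Step 3 holds for a.e. `φ ∈ (0,π/2)`, the jump vanishes there by (iv), and `jump_positivity_ae`
  gives `G(0,π/2) = 0`; symmetrically (or by the same argument in the lower-right quadrant)
  `G(π/2,π) = 0`. ✓
  (vii) The endpoint `p = 1` (`Δ = 1/2`), where `e^{2πip} - 1 = 0`: by `atom_pOne_partialFraction` the
  pencil is a Cauchy transform `C_μ(t) = ∫dμ(ζ)/(t-ζ)` of the complex measure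
  `μ = (e^{iθ})_*(W G/(2i sin θ)) - (e^{-iθ})_*(W G/(2i sin θ))` on the unit circle; on the open arc
  `A = {e^{iφ} : 0 < φ < π/2}` only the first term lives (`e^{-iθ}` is in the lower half plane, atoms
  `θ > π/2` in the left one). If `C_μ` continues analytically across `A`, then for `χ ∈ C_c^∞(A)`:
  `∫χ(ζ)[C_μ((1-ε)ζ) - C_μ((1+ε)ζ)]dζ → 2πi∫χ dμ` (weak Plemelj: the difference kernel is an
  approximate identity along the arc), while the left side `→ 0` by continuity of the extension; so
  `μ|_A = 0`, i.e. `G(0,π/2) = 0` (density `W/(2 sin θ) > 0`). Thus `SliceRigidity 1` and the crux at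
  `Δ = 1/2` hold too. ✓ (The same weak-jump argument is an alternative to (vi) for every `p`.)
  (viii) Second swap `x₂ = x₃` (normal `e₁ - e₂` with `(i,j) = (1,2)`, a NineNormal) gives `ω₂ = ω₃`
  `Φ`-a.e.; so `Φ = m δ_{(1/3,1/3,1/3)}`, `K(x) = m Γ(Δ) 3^Δ ‖x‖^{-2Δ}` off `0`, `K 0 = 0` by
  homogeneity, and `K ∘ R = K` for every linear isometry. ✓
  VERDICT: F3 is a correct proof of `GSMRigidity`. No counterexample exists; this seat cannot fire.
  What remains is formalisation (F6), not mathematics.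
* F9 (simplifications and sharpenings for the prover, found in the audit).
  (i) Montel is avoidable: by F8(ii) the `k_w = 0` pencil is finite, and a pointwise limit
  (`k_w ↓ 0`, monotone) of Stieltjes functions that is finite is Stieltjes; then F8(iii) applies to it
  directly. (ii) In F2 "a.e. `q`" can be "every `q ≠ 0`" (localisation, F8(i)). (iii) ONE diagonal RP
  suffices given the invariance conjuncts: `K` is `B₃`-invariant, so `Φ` may be replaced by its
  `S₃`-average (same `K`, Laplace uniqueness); one swap gives `ω₁ = ω₂` a.e., and an `S₃`-invariant
  measure carried by `{ω₁ = ω₂}` is carried by the centre. So in the crux, of the nine RPs only ONE of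
  the six diagonal ones is load-bearing (the three coordinate RPs hold for every GSM kernel with
  `Δ ≥ 1/2`, Frank–Lieb). Without the invariance conjuncts two swaps are needed (F4). (iv) SIGNED
  mixing measures: if only the vanishing of the jumps is known, `∫_{(0,φ)}(cos θ - cos φ)^{-p}dG(θ) = 0`
  for a.e. `φ` is a generalised Abel equation (substitute `x = cos θ`: a Riemann–Liouville integral of
  order `1-p` of `G̃`), injective on signed measures too; so "nine-mirror RP + homogeneity ⇒ round"
  holds on the SIGNED cone `{Γ(Δ)∫(ω·x²)^{-Δ}dΦ : Φ signed, ∫ωᵢ^{-Δ}d|Φ| < ∞}` as well (there the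
  coordinate RPs and positivity are genuine hypotheses). Information for the HRP2Rigidity seat: its
  dead class "mixtures of quadrics" extends to signed mixtures. (v) `Δ ≤ 1` is used nowhere; for
  `1 < Δ < 3/2` (`0 < p < 1/2`) F3 is verbatim.
* F10 (closed form of the SWAP TIME FUNCTION; the quantitative law behind F5 and the certificates).
  Mirror time `u = (x₁-x₂)/√2 > 0`, transverse momentum `(k_v, k_w)` along `((e₁+e₂)/√2, e₃)`. For the
  atom `∫₀^∞ r^{Δ-1} e^{-r ω·x²} dr = Γ(Δ)(ω·x²)^{-Δ}` (Gaussian integrals in `v, w`; `ω·x² = σ(u²+v²) +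
  κuv + ω₃w²`, `σ = (ω₁+ω₂)/2`, `κ = ω₁-ω₂`):
  `k̃_ω(u; k_v, k_w) = (π/√(σω₃)) e^{iρ k_v u} ∫₀^∞ r^{Δ-2} e^{-η u² r - C_q/r} dr
   = (2π/√(σω₃)) e^{iρ k_v u} (C_q/(ηu²))^{(Δ-1)/2} K_{1-Δ}(2u√(ηC_q))`,
  `η = 2ω₁ω₂/(ω₁+ω₂)`, `ρ = (ω₁-ω₂)/(ω₁+ω₂)`, `C_q = k_v²/(4σ) + k_w²/(4ω₃)`; at `k_w = 0`,
  `2u√(ηC_q) = k_v u √(1-ρ²)`: complex decay rate `k_v(√(1-ρ²) ∓ iρ) = k_v e^{∓iθ'}`, `sin θ' = ρ` (the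
  mechhunt note's "shear phase"; `cos θ_ω = ρ_ω` in F3's convention) — the `u`-side face of the circle
  lemma. RP ⇔ `u ↦ K̃(u;q) = ∫k̃_ω dΦ` completely monotone for every `q ≠ 0`; in particular `K̃ ≥ 0`.
  NUMBERS (`num/swap_time_function.py`, pure-python quadrature; planner family = six atoms): first zero
  `u*` of `K̃(u; 1, 0)` — `Δ = 0.518`: `ε = 0.9, 0.5, 0.2, 0.1, 0.05 ↦ u* = 2.35, 4.42, 11.58, 23.53,
  47.44`; `Δ = 1`: `2.15, 4.32, 11.53, 23.50, 47.43`. Small-`ε` law: the three swap pairs have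
  `ρ = ε, ε/(2+ε), -ε/(2-ε)` and equal weights to `O(ε)`, so `K̃ ∝ cos(εu) + 2cos(εu/2) + O(ε)` and
  `ε u* → x* := 2 arccos((√3-1)/2) = 2.392` (computed `εu* = 2.37` at `ε = 0.05`); the negative lobe has
  depth `~ e^{-u* k_v √(1-ε²)} ≈ e^{-2.39/ε}` relative to `u = O(1)`: `-2.8·10⁻²¹` against `K̃(1;1,0) = 43`
  at `ε = 0.05`. THIS is why cycle 1's double-precision Gram search (F5(ii)) could not resolve
  `ε = 0.05`, and it matches the EXACT `Δ = 1` law of the binomial certificates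
  (`num/binomial_table.py`, rational arithmetic, chains `(A + aD, -A + aD, 0)`, `A ≤ 16`, `D ≤ 3`):
  minimal order `n` (chain of `n+1` points, coefficients `(-1)^a C(n,a)`, RP form = `2n`-th central
  difference of `d ↦ k(2A + dD, dD - 2A, 0)`) is `n = 2, 3, 3, 4, 5, 6, 7, 8, 10, 12` for
  `ε = 1/2, 2/5, 1/3, 3/10, 1/4, 1/5, 1/6, 1/7, 1/8, 1/10` — `nε ∈ [1.0, 1.25]`, `2nε ≈ x*` — with relative
  size `-1.4·10⁻³, -3.9·10⁻⁴, -5·10⁻⁸, -5.7·10⁻⁶, -5·10⁻⁷, -8.9·10⁻¹⁰, -3.5·10⁻¹³, -3.8·10⁻¹⁸,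
  -2·10⁻¹⁵, -3·10⁻²²`. No anisotropy is small enough to be swap-RP; the price of seeing it is a chain of
  length `≈ 1.2/ε` and `≈ 1/ε` digits. (RP ⇒ `d ↦ k(2A+dD, dD-2A, 0)` is a positive-definite sequence,
  so all its even central differences alternate correctly; the certificates are single failures of that.)

## Cycle 3 (seat g3, 2026-08-16)

* F11 (TARGETS PRE-ATTACK — the three registered lines, 15 stubs, Lean signatures read symbol by symbol.
  NO STUB IS FALSE. Per stub: verdict, the Lean-level traps checked, what is load-bearing.)
  LINE `momentum-one-amplitude` (the registered skeleton; stubs S1–S5):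
  S1 `stub_mixingMeasureStructure` TRUE — direction of the homogeneity clause checked:
  `K(√c·x) = c^{-Δ}K(x)` ⇔ `(c•)_*ν = c^{-Δ}ν` ⇔ `ν.map (c • ·) = ofReal(c^{-Δ}) • ν` ✓; origin/faces are
  dilation invariant of finite mass (integrability at `eᵢ`, `(1,1,1)`) hence null; the `S₃`-average is
  legitimate because ALL nine invariances are hypotheses; `ν = 0` (then `K = 0` off `0`) is harmless.
  S2 `stub_pencilStieltjes` TRUE for EVERY unit `n` of the plane `k₂ = 0` (not only lattice normals): if
  `∠(n,e₀) ∉ (π/4)ℤ`, the invariance hypothesis alone forces `s₀ = s₁` `ν`-a.e. (the even angular modes of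
  an exchangeable planar GSM are `2∫e^{-r²σ}I_{2m}(r²κ)dν > 0` unless `κ = (s₀-s₁)/2 = 0` a.e., and the
  rotation by `2∠(n,e₀)` must fix the mode `4`), so the pencil is `C(t²+|q|²)^{-p}`, `p = 3/2-Δ ≤ 1`;
  for `n = e₀` it is the positive mixture `∫c_ω ω₀^p (t² + q₁²ω₀/ω₁)^{-p}(ω₀ω₁ω₂)^{-1/2}dΦ` of
  Stieltjes atoms — NO RP NEEDED; only the diagonal `n` carries RP content (F9(iii)). Off-axis finiteness of
  the dual integrand ✓ by the vertex/edge majorants of F8(ii) (`Δ ≥ 1/2` enters here); the Stieltjes `g`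
  may blow up at `t → 0⁺` (`n = e₀`: allowed, `a/s` + heavy `σ` near `0`). PROVER WARNING: the naive
  absolute-Fubini majorant identifying the `u`-Fourier transform `∫2E/(E²+t²)dμ_q` with the pointwise dual
  integral at an in-plane point is `Ǩ` AT AN AXIS POINT (block inversion: `(S⁻¹)_⊥ ≥ (S_⊥)⁻¹`), infinite
  for `Δ < 1` in general — regularise (`q + εe₂`, or smear in `u`) and pass to the limit monotonically
  (F9(i)). S3 `stub_dualProfileRegular` TRUE; the second trace identity is demanded also at `θ = π/4`, an
  AXIS point outside S2's reach — fine with `g₂ :=` S2's `g` for `c = 1`, because as `t ↓ 1` BOTH dual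
  coordinates `(t-1)²/2 ↓ 0`, `(t+1)²/2 ↓ 2` decrease, so `D_ν ↑` and monotone convergence gives
  `D_ν(0,2) = lim g(t²) = g(1) < ∞` (Stieltjes `g` is continuous on `(0,∞)`); axis finiteness (i) the same
  way at `t ↓ c`; (iii) trivial (`cos², sin²` and `s₀ ↔ s₁`); (iv) `M₀ = 2^a D_ν(1,0)` by monotonicity +
  homogeneity `D_ν(λu,λv) = λ^{-a}D_ν(u,v)`, `a = 3/2-Δ` (direction checked against the `ν.map` clause).
  S4 `stub_stieltjesHalfPlane` TRUE (sector bound: `|t²+E|² - (Re t/|t|)²(|t|²+E)² = sin²φ (|t|²-E)² ≥ 0`;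
  `M₀ < 0` is vacuous since Stieltjes `g ≥ 0`), and `1 ≤ β` is NECESSARY — certified
  `stieltjesHalfPlane_false_at_beta_half` (`g = (s+1)⁻¹`, `β = 1/2`, `M₀ = 1`: the unique continuation
  `(t²+1)⁻¹` has `‖F(1/9 + i)‖ = 81/√325 > 3 = (Re t)^{-1/2}`): THIS line uses `Δ ≤ 1` (`β = 3-2Δ ≥ 1`)
  essentially; F3 and the x-side line do not. S5 `stub_oneAmplitudeMomentum` TRUE (AM–GM equality case,
  `w > 0` on the open octant, `integral_eq_zero_iff_of_nonneg`; no σ-finiteness needed; `x = 0` trivial by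
  `R 0 = 0`), exchangeability NECESSARY — certified `oneAmplitudeMomentum_false_without_exchangeability`
  (`ν = δ_{(1,1,2)}`: the identity only sees `s₀ = s₁`). `profile_const` and the composition are
  kernel-checked by the planner.
  LINE `swap-pencil-branch-arc` (= F3; stubs S1, S2a, S2b, S3, S4, S5): S1 TRUE. S2a `stub_bernsteinWidder`
  TRUE (Widder VI.21 two-sided representation + boundedness on `[1,∞)` kills `t < 0`; IN-TREE route:
  `Literature.Analysis.OperatorTheory.IsBoundedHalfLinePD.exists_laplace_repr` (PROVED, GNS + spectral
  theorem) gives `f(2s+t) = ∫e^{-tE}dν_s`, glue one `μ := e^{2sE}ν_s` by Laplace uniqueness; its `bdd` on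
  every `[t₀,∞)` follows from bounded on `[1,∞)` + the 2×2 minors `f(u+u')² ≤ f(2u)f(2u')` (log-convex +
  bounded at `∞` ⇒ non-increasing)). S2b TRUE (implied by one-swap rigidity itself: if `Φ{ωᵢ≠ωⱼ} = 0` take
  `G = 0`, `g = 0`; else the intended `G`). S3 `stub_pencilContinuation` TRUE FOR EVERY `p > 0` (even
  analytic `f` on the unit disc ⇒ `h(s)` analytic on the unit `s`-disc, real on `(-1,1)`; Stieltjes–Perron
  against `C_c((0,1))` kills `σ|(0,1)`, boundedness at `0⁺` kills `a`; `F := b + ∫_{[1,∞)}dσ(τ)/(z²+τ)`,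
  dominated by `C_z(1+τ)⁻¹`); symmetry of `G` necessary as the card says (`(s + 2c√s + 1)^{-p}` IS Stieltjes
  for `0 < p ≤ 1`: `arg` stays in `(-pπ,0)` on the upper half-plane). S4 `stub_sliceRigidity` TRUE with NO
  symmetry of `G` (identity theorem from `(0,1)` and from `(1,∞)` separately; atoms `θ > φ`, atoms in
  `(π/2,π)` and all conjugate factors are continuous at `e^{iφ}`). S5 TRUE (atomic `G` is excluded by its
  own poles in `U`, in BOTH quadrants). `p > 0` load-bearing: `not_sliceRigidity_zero` (at `p = 0` every
  pencil is the constant `G(0,π)`).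
  LINE `tilted-lightcone-jump-positivity` (x-side; 4 stubs; NO Fourier-analysis stub — the most
  formalisable line): S1 TRUE (the disintegration-free `Φ := ΔΓ(Δ)|s|₁^Δ 1_{|s|₁≤1}ν` checked:
  `∫₀¹ r^{Δ-1}dr = 1/Δ`). S2 `stub_halfPlaneExtension` TRUE and essentially IN THE TREE
  (`exists_laplace_repr` + `eqOn_rhp_of_eqOn_ofReal`-type gluing; `ContinuousOn` redundant given `bdd`;
  `bdd` unnecessary for the conclusion, harmless, and supplied by `twoRow_bdd`). S3 `SliceNoMass Δ`,
  `0 < Δ < 1`: TRUE AND ROBUST, audited end to end — `J = T + 1/T` maps `D± = {|T| ≷ 1, Re T > 0}`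
  biholomorphically onto `{Re w > 0}∖(0,2]` (`Re J = (r+1/r)cos θ`, `J` real only on the axis); `F = S∘J` on
  `D±` by the identity theorem from `(1,∞)`, resp. `(0,1)`; at `e^{iθ}`: `Im F ≤ 0` (outside) and `≥ 0`
  (inside), so `= 0`; EVERY TERM HAS A SIGN — certified `im_cpow_neg_neg` / `im_cpow_neg_pos`
  (`Im (w-c)^{-Δ} < 0` for `Im w > 0`, all real `c`, `0 < Δ ≤ 1`); the approach `J(re^{iθ}) → 2cos θ` is
  vertical (`Re - w₀ = O((r-1)²)`, `Im = O(r-1)`); Fatou gives `ρ((w₀,2]) = 0` AND `ρ{w₀} = 0` (the `c = w₀`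
  term tends to `+∞`) for every `w₀ ∈ (0,2)` — the conclusion could even be `ρ((0,2]) = 0`; the
  `Real.rpow` junk for `c > T + 1/T > 2` is `ρ`-null. S4 (`Δ = 1`) TRUE (Fatou only removes atoms;
  Stieltjes–Perron needs locally uniform boundary convergence, available: `F` is uniformly continuous near
  compact sub-arcs and `J₊⁻¹` is continuous up to the slit). `Δ > 0` load-bearing:
  `not_sliceNoMassX_zero`. The compositions `GSMRigidity_of` of all three lines are kernel-checked by their
  planners; the x-side line's only genuinely new Lean work is S3/S4 (one complex variable) and S1.
* F12 (LOAD-BEARING ANALYSIS continued — HOMOGENEITY; F4 had "unclear"). F3 uses homogeneity at exactly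
  one place: the circle lemma. Without it a GSM component of shape `ω` carries an arbitrary scale law
  `μ_ω(dη)`, its `t`-side pencil is `L_ω(t² - 2ρ_ω k_v t + k_v²)` with `L_ω(z) = ∫e^{-z/(4η)}dμ_ω` a Laplace
  transform, singular (Landau–Pringsheim) where the quadratic equals the abscissa `-m_ω² ≤ 0` of `L_ω`:
  `m_ω = 0` (sub-exponential tails — every homogeneous `ν`, every "critical" component) ⇒ ON the circle
  `|t| = k_v` whatever the scale law, so F3 survives massless inhomogeneity; `m_ω > 0` (massive, e.g. the
  sheared Yukawa `e^{-m|A_ω x|}/|A_ω x|`, an honest RP-compatible GSM atom) ⇒ roots of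
  `a_ω(t² - 2ρ_ω k_v t + k_v²) + m²`, product `k_v² + m²·2ω₁ω₂/(ω₁+ω₂)` — ONE CIRCLE PER ATOM (certified
  `swapSlice_factor_massive`; formally the off-plane pencil `swapSlice_factor_offplane` with
  `k_w²/ω₃ ↔ m²`). `GSMRigidityWithoutHomogeneity` (def below; implies the crux,
  `gsmRigidity_of_withoutHomogeneity`) is OPEN: finite atomic massive mixtures stay rigid (meromorphic /
  algebraic pencils with singularities at `Re t = ρ_ω k_v ≠ 0` are not Stieltjes in `t²`); a diffuse
  massive `Φ` would need its outside continuation to cross a 2-D cloud of circles singularity-free for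
  every `(k_v,k_w)` — no mechanism known either way, no witness. Irrelevant to the route (limit kernels
  are homogeneous), but it pins where homogeneity enters EVERY line (polar form + one circle / Joukowski).
  By-product (radial case, for the record): a RADIAL Gaussian scale mixture `∫e^{-s‖x‖²}dμ(s)` is RP iff
  `μ(ds) = s^{-1/2}∫ m e^{-m²/(4s)}dτ(m) ds`, i.e. iff `K` is a Yukawa mixture `∫ e^{-m‖x‖}/‖x‖ dτ'(m)`
  (Bernstein in `u` at `q → 0` + `1/2`-stable subordination + Laplace uniqueness in `u²`; then every `q`
  is automatic): RP GSM kernels are necessarily singular like `1/‖x‖` at the origin, and `‖x‖^{-2Δ}`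
  needs `1-2Δ ≤ 0` — Frank–Lieb's threshold recovered inside the cone.
* F13 (window; quantitative form of F4's "Δ < 1/2 is vacuous"). For `‖x‖^{-2Δ}` the mirror-time
  function is `∝ (u|q|)^ν K_ν(|q|u)`, `ν = 1-Δ`, and `u^νK_ν(u) = 2^{ν-1}Γ(ν)[1 - (Γ(1-ν)/Γ(1+ν))(u/2)^{2ν}
  + O(u²)]` is log-CONCAVE at `0⁺` iff `ν > 1/2 ⇔ Δ < 1/2`: RP fails through TWO rows at small mirror time
  `u ≪ 1/|q|` (one row never fails: `y ↦ (a²+|y|²)^{-Δ}` is positive definite for every `Δ > 0`). Values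
  irrational — no `norm_num` certificate; the finite shape of Frank–Lieb necessity.
* F14 (certified in cycle 3, all sorry-free, section "Cycle 3" below; landing file
  `Theorems/GSMRigidity/Negative/LeverTightness.lean`): `swapSlice_factor_massive`,
  `GSMRigidityWithoutHomogeneity`/`gsmRigidity_of_withoutHomogeneity`, `eqOn_rhp_of_eqOn_ofReal`,
  `stieltjesHalfPlane_false_at_beta_half`, `oneAmplitudeMomentum_false_without_exchangeability`,
  `im_cpow_neg_neg`, `im_cpow_neg_pos`, `not_sliceRigidity_zero`, `SliceNoMassX`/`not_sliceNoMassX_zero`,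
  and the x-side gluing/bookkeeping tools `eqOn_of_isPreconnected_of_eqOn_Ioo` (identity theorem from a real
  interval inside any open preconnected `U` — `D±` from `(1,∞)`/`(0,1)`, the disc from `(0,1)`), `im_add_inv`,
  `re_add_inv`, `im_add_inv_pos`, `im_add_inv_neg`, `re_add_inv_pos`, `add_inv_im_eq_zero_iff`, `two_lt_add_inv`
  (`Im J = Im T(1-1/|T|²)`, `Re J = Re T(1+1/|T|²)`: `J(D±)` misses the slit `(0,2]`, upper/lower sides as claimed),
  and the BOUNDARY VALUES of the lever atoms from the closed upper half-plane
  (`tendsto_cpow_neg_nhdsWithin_im_nonneg`: `(w-c)^{-Δ} → (c-w₀)^{-Δ}e^{-iπΔ}` as `w → w₀ < c`;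
  `tendsto_cpow_neg_im_nhdsWithin_im_nonneg`, `lever_boundary_im_neg`: its imaginary part
  `-(c-w₀)^{-Δ} sin(πΔ) < 0` for `0 < Δ < 1`) — with `im_cpow_neg_neg` and Mathlib's `lintegral_liminf_le`
  (Fatou) these are ALL the analytic atoms of `stub_sliceNoMass_lt_one` except the biholomorphy of `J` on `D±`;
  and the HOLOMORPHY OF `S(w) = ∫(w-c)^{-Δ}dρ(c)` OFF THE CUT `(-∞,2]` (`differentiableOn_orderStieltjes`, with
  the separation lemma `slit_separation`: parametric differentiation, dominated derivative `|Δ|(m/2)^{-Δ-1}`),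
  plus `mapsTo_joukowski_outer/inner` (`J(D±) ⊆ ℂ∖(-∞,2]`), `outer/inner_eq_image_polar`,
  `isPreconnected_outer/inner`, `isOpen_outer/inner` — so `F = S∘J` on `D±` is now three certified lemmas +
  `eqOn_of_isPreconnected_of_eqOn_Ioo` away; what remains of x-side S3 for a prover: the two one-sided limits at
  `e^{iθ}` and Fatou (`lintegral_liminf_le`) with the certified boundary values — AND THEN DONE HERE TOO:
  `sliceNoMassX_of_lt_one : 0 < Δ → Δ < 1 → SliceNoMassX Δ` (with `S_J_real`, `noMass_Ioc`) is a complete,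
  sorry-free, standard-axioms proof of the x-side line's HARDEST stub `stub_sliceNoMass_lt_one` over the
  verbatim restatement (landed form: `Negative.sliceNoMass_of_lt_one`, stated with the line's defs UNFOLDED;
  the lead closes the stub by `exact fun Δ h0 h1 => Negative.sliceNoMass_of_lt_one h0 h1` — defeq unfolding
  of `SliceNoMass`/`joukStieltjes`/`rightHalfPlane`, checked on verbatim copies). What remains of that line: S1 (polar form,
  shared), S2 (Bernstein–Widder, in tree modulo glue), S4 (`Δ = 1`, Stieltjes–Perron).
  ADVERSARY'S VIEW FOR THE LEAD (not a pick): by formalisation risk the x-side line is cheapest (S2 in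
  tree; S3/S4 = one complex variable with a certified sign; S1 shared by all lines); the momentum line's
  S2 carries the full transverse-Plancherel dictionary and its S4/S5 hypotheses are tight as certified; the
  k-side arc line is F3 verbatim with the same dictionary debt (S2b) plus `Complex.cpow` monodromy along
  arcs (S4).
-/

noncomputable section

open scoped BigOperators InnerProductSpace
open MeasureTheory Set Literature.MathematicalPhysics.QuantumFieldTheory

namespace Summit.CriticalPhenomena.Ising3DConformalLimit.Cruxes.GSMRigidity.Disproof

abbrev E3 := EuclideanSpace ℝ (Fin 3)

/-! ## The crux, split into its conjuncts (verbatim sub-formulas) -/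

/-- The nine-normal shape predicate, verbatim from the crux. -/
def NineNormal (n : E3) : Prop :=
  ∃ i j : Fin 3, i ≠ j ∧ (n = EuclideanSpace.single i 1 ∨
    n = EuclideanSpace.single i 1 + EuclideanSpace.single j 1 ∨
    n = EuclideanSpace.single i 1 - EuclideanSpace.single j 1)

/-- The reflection-positivity conjunct of the crux, verbatim
(`= Literature.MathematicalPhysics.QuantumFieldTheory.IsMirrorRPKernel n K`, `Iff.rfl`). -/
def RPForm (n : E3) (K : E3 → ℝ) : Prop :=
  ∀ (m : ℕ) (p : Fin m → E3) (c : Fin m → ℝ), (∀ a, 0 < inner ℝ (p a) n) →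
    0 ≤ ∑ a, ∑ b, c a * c b * K (p a - ((ℝ ∙ n)ᗮ).reflection (p b))

theorem rpForm_iff_isMirrorRPKernel (n : E3) (K : E3 → ℝ) :
    RPForm n K ↔ IsMirrorRPKernel n K := Iff.rfl

/-- The Gaussian-scale-mixture conjunct of the crux, verbatim. -/
def IsGSM (K : E3 → ℝ) : Prop :=
  ∃ ν : MeasureTheory.Measure (Fin 3 → ℝ), ν {s | ∃ i, s i < 0} = 0 ∧
    ∀ x, x ≠ 0 → MeasureTheory.Integrable (fun s => Real.exp (-∑ i, s i * (x i) ^ 2)) ν ∧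
      K x = ∫ s, Real.exp (-∑ i, s i * (x i) ^ 2) ∂ν

/-- The crux is literally the conjunction-shaped statement built from the pieces above. -/
theorem gsmRigidity_iff :
    Summit.CriticalPhenomena.Ising3DConformalLimit.Theses.GaussianScaleMixture.GSMRigidity ↔
      ∀ (Δ : ℝ) (K : E3 → ℝ), 1/2 ≤ Δ → Δ ≤ 1 → ContinuousOn K {0}ᶜ → (∀ x, x ≠ 0 → 0 < K x) →
        (∀ c : ℝ, 0 < c → ∀ x, K (c • x) = c ^ (-(2 * Δ)) * K x) →
        (∀ n : E3, NineNormal n → (∀ x, K (((ℝ ∙ n)ᗮ).reflection x) = K x) ∧ RPForm n K) →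
        IsGSM K → ∀ (R : E3 ≃ₗᵢ[ℝ] E3) (x : E3), K (R x) = K x :=
  Iff.rfl

/-! ## The witness kernel `Σᵢ 1/(‖x‖² + xᵢ²)` -/

/-- The exchangeable three-atom Gaussian scale mixture at `Δ = 1`:
`K x = Σᵢ 1/(Σⱼ xⱼ² + xᵢ²) = Σᵢ ∫₀^∞ exp(-r(‖x‖² + xᵢ²)) dr`. -/
def threeAtomKernel (x : E3) : ℝ := ∑ i, 1 / ((∑ j, x j ^ 2) + x i ^ 2)

theorem exists_coord_ne_zero {x : E3} (hx : x ≠ 0) : ∃ i, x i ≠ 0 := by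
  by_contra h
  push Not at h
  exact hx (PiLp.ext fun i => by simpa using h i)

theorem sum_sq_pos {x : E3} (hx : x ≠ 0) : 0 < ∑ i, x i ^ 2 := by
  obtain ⟨i, hi⟩ := exists_coord_ne_zero hx
  exact Finset.sum_pos' (fun j _ => by positivity) ⟨i, Finset.mem_univ _, by positivity⟩

theorem denom_pos {x : E3} (hx : x ≠ 0) (i : Fin 3) : 0 < (∑ j, x j ^ 2) + x i ^ 2 :=
  add_pos_of_pos_of_nonneg (sum_sq_pos hx) (sq_nonneg _)

theorem threeAtomKernel_pos {x : E3} (hx : x ≠ 0) : 0 < threeAtomKernel x :=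
  Finset.sum_pos (fun i _ => one_div_pos.2 (denom_pos hx i)) Finset.univ_nonempty

theorem continuous_coord (i : Fin 3) : Continuous fun x : E3 => x i :=
  (EuclideanSpace.proj i).continuous

theorem threeAtomKernel_continuousOn : ContinuousOn threeAtomKernel {0}ᶜ := by
  have hs : Continuous fun x : E3 => ∑ j, x j ^ 2 :=
    continuous_finsetSum _ fun j _ => (continuous_coord j).pow 2
  refine continuousOn_finsetSum _ fun i _ => ?_
  refine ContinuousOn.div continuousOn_const (hs.add ((continuous_coord i).pow 2)).continuousOn ?_
  intro x hx
  exact (denom_pos hx i).ne'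

theorem threeAtomKernel_smul {c : ℝ} (hc : 0 < c) (x : E3) :
    threeAtomKernel (c • x) = c ^ (-(2 * (1:ℝ))) * threeAtomKernel x := by
  unfold threeAtomKernel
  rw [show (-(2 * (1:ℝ))) = ((-2 : ℤ) : ℝ) by norm_num, Real.rpow_intCast, Finset.mul_sum]
  refine Finset.sum_congr rfl fun i _ => ?_
  simp only [PiLp.smul_apply, smul_eq_mul, mul_pow]
  rw [← Finset.mul_sum]
  have hc2 : c ^ 2 ≠ 0 := pow_ne_zero _ hc.ne'
  by_cases hD : (∑ j, x j ^ 2) + x i ^ 2 = 0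
  · have : c ^ 2 * ∑ j, x j ^ 2 + c ^ 2 * x i ^ 2 = 0 := by rw [← mul_add, hD, mul_zero]
    rw [this, hD]; simp
  · field_simp

/-- coordinate-even, permutation-symmetric sums are invariant under the nine lattice mirrors
(copied from the HRP2Rigidity disproof work file, same proof). -/
theorem sum_comp_reflection_eq (F : ℝ → ℝ) (hF : ∀ a, F (-a) = F a) (n : E3)
    (hn : NineNormal n) (x : E3) :
    ∑ l, F (((ℝ ∙ n)ᗮ.reflection x) l) = ∑ l, F (x l) := by
  obtain ⟨i, j, hij, rfl | rfl | rfl⟩ := hn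
  · refine Finset.sum_congr rfl fun l _ => ?_
    rw [reflection_single_apply]
    split_ifs <;> simp [hF]
  · calc ∑ l, F (((ℝ ∙ (EuclideanSpace.single i (1:ℝ) + EuclideanSpace.single j 1))ᗮ.reflection x) l)
        = ∑ l, F (x (Equiv.swap i j l)) := by
          refine Finset.sum_congr rfl fun l _ => ?_
          rw [reflection_single_add_single_apply hij]
          by_cases hli : l = i
          · subst hli; simp [hF]
          · by_cases hlj : l = j
            · subst hlj; simp [hli, hF]
            · simp [hli, hlj, Equiv.swap_apply_of_ne_of_ne hli hlj]
      _ = ∑ l, F (x l) := Equiv.sum_comp (Equiv.swap i j) (fun l => F (x l))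
  · calc ∑ l, F (((ℝ ∙ (EuclideanSpace.single i (1:ℝ) - EuclideanSpace.single j 1))ᗮ.reflection x) l)
        = ∑ l, F (x (Equiv.swap i j l)) := by
          refine Finset.sum_congr rfl fun l _ => ?_
          rw [reflection_single_sub_single_apply hij]
      _ = ∑ l, F (x l) := Equiv.sum_comp (Equiv.swap i j) (fun l => F (x l))

theorem threeAtomKernel_reflection (n : E3) (hn : NineNormal n) (x : E3) :
    threeAtomKernel (((ℝ ∙ n)ᗮ).reflection x) = threeAtomKernel x := by
  unfold threeAtomKernel
  rw [sum_comp_reflection_eq (fun a => a ^ 2) (fun a => by ring) n hn x]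
  exact sum_comp_reflection_eq (fun a => 1 / ((∑ j, x j ^ 2) + a ^ 2)) (fun a => by ring) n hn x

/-- the body diagonal `(1,1,1)` -/
def v111 : E3 :=
  EuclideanSpace.single 0 1 + EuclideanSpace.single 1 1 + EuclideanSpace.single 2 1

theorem v111_apply (l : Fin 3) : v111 l = 1 := by
  unfold v111
  fin_cases l <;> simp

theorem reflection_v111_e0_apply (l : Fin 3) :
    ((ℝ ∙ v111)ᗮ.reflection (EuclideanSpace.single (0 : Fin 3) (1 : ℝ))) l =
      (if l = 0 then 1 else 0) - 2 / 3 := by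
  have hinner : ⟪EuclideanSpace.single (0 : Fin 3) (1 : ℝ), v111⟫_ℝ = 1 := by
    rw [inner_single_one_left, v111_apply]
  have hnorm : ‖v111‖ ^ 2 = 3 := by
    rw [EuclideanSpace.norm_eq, Real.sq_sqrt (Finset.sum_nonneg fun _ _ => by positivity)]
    norm_num [v111_apply, Fin.sum_univ_three]
  rw [mirrorReflection_apply, hinner, hnorm]
  norm_num [v111_apply]

theorem threeAtomKernel_e0 : threeAtomKernel (EuclideanSpace.single (0 : Fin 3) (1 : ℝ)) = 5 / 2 := by
  unfold threeAtomKernel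
  simp [Fin.sum_univ_three]
  norm_num

theorem threeAtomKernel_reflection_v111_e0 :
    threeAtomKernel ((ℝ ∙ v111)ᗮ.reflection (EuclideanSpace.single (0 : Fin 3) (1 : ℝ))) = 297 / 130 := by
  unfold threeAtomKernel
  have h0 : ((ℝ ∙ v111)ᗮ.reflection (EuclideanSpace.single (0 : Fin 3) (1 : ℝ))) 0 = 1 / 3 := by
    rw [reflection_v111_e0_apply, if_pos rfl]; norm_num
  have h1 : ((ℝ ∙ v111)ᗮ.reflection (EuclideanSpace.single (0 : Fin 3) (1 : ℝ))) 1 = -(2 / 3) := by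
    rw [reflection_v111_e0_apply, if_neg (by decide)]; norm_num
  have h2 : ((ℝ ∙ v111)ᗮ.reflection (EuclideanSpace.single (0 : Fin 3) (1 : ℝ))) 2 = -(2 / 3) := by
    rw [reflection_v111_e0_apply, if_neg (by decide)]; norm_num
  simp only [Fin.sum_univ_three, h0, h1, h2]
  norm_num

/-! ### The witness IS a Gaussian scale mixture (an honest measure `ν`) -/

/-- the ray `r ↦ r (𝟙 + eᵢ)` in the closed octant -/
def rayVec (i : Fin 3) (r : ℝ) : Fin 3 → ℝ := fun j => r * (if j = i then 2 else 1)

theorem measurable_rayVec (i : Fin 3) : Measurable (rayVec i) :=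
  measurable_pi_lambda _ fun _ => measurable_id.mul_const _

/-- `ν = Σᵢ (rayVec i)_* (Lebesgue on (0,∞))` -/
def gsmMeasure : Measure (Fin 3 → ℝ) :=
  ∑ i : Fin 3, Measure.map (rayVec i) (volume.restrict (Ioi (0:ℝ)))

theorem measurableSet_negSet : MeasurableSet {s : Fin 3 → ℝ | ∃ i, s i < 0} := by
  rw [Set.setOf_exists]
  exact MeasurableSet.iUnion fun i => measurableSet_lt (measurable_pi_apply i) measurable_const

theorem gsmMeasure_negSet : gsmMeasure {s | ∃ i, s i < 0} = 0 := by
  rw [gsmMeasure, Measure.finsetSum_apply]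
  refine Finset.sum_eq_zero fun i _ => ?_
  rw [Measure.map_apply (measurable_rayVec i) measurableSet_negSet,
    Measure.restrict_apply' measurableSet_Ioi]
  have : rayVec i ⁻¹' {s : Fin 3 → ℝ | ∃ i, s i < 0} ∩ Ioi 0 = ∅ := by
    ext r
    simp only [Set.mem_inter_iff, Set.mem_preimage, Set.mem_setOf_eq, Set.mem_Ioi,
      Set.mem_empty_iff_false, iff_false, not_and, forall_exists_index]
    intro j hj hr
    have : 0 < rayVec i r j := by
      unfold rayVec; split_ifs <;> nlinarith
    linarith
  rw [this, measure_empty]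

theorem sum_rayVec_mul_sq (i : Fin 3) (x : E3) (r : ℝ) :
    ∑ j, rayVec i r j * (x j) ^ 2 = ((∑ j, x j ^ 2) + x i ^ 2) * r := by
  fin_cases i <;> simp [rayVec, Fin.sum_univ_three] <;> ring

theorem continuous_gaussIntegrand (x : E3) :
    Continuous fun s : Fin 3 → ℝ => Real.exp (-∑ i, s i * (x i) ^ 2) :=
  Real.continuous_exp.comp (continuous_finsetSum _ fun i _ =>
    (continuous_apply i).mul continuous_const).neg

/-- `∫₀^∞ e^{-l u} du = 1/l` for `l > 0`. [folklore] -/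
theorem integral_exp_neg_mul_Ioi {l : ℝ} (hl : 0 < l) :
    ∫ u in Ioi (0 : ℝ), Real.exp (-(l * u)) = 1 / l := by
  have h := integral_exp_mul_Ioi (a := -l) (by linarith) 0
  simp only [mul_zero, Real.exp_zero, neg_mul] at h
  rw [h, neg_div_neg_eq]

theorem threeAtomKernel_isGSM : IsGSM threeAtomKernel := by
  refine ⟨gsmMeasure, gsmMeasure_negSet, fun x hx => ?_⟩
  set g : (Fin 3 → ℝ) → ℝ := fun s => Real.exp (-∑ i, s i * (x i) ^ 2) with hg
  have hgc : Continuous g := continuous_gaussIntegrand x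
  have hcomp : ∀ i, g ∘ rayVec i = fun r => Real.exp (-((∑ j, x j ^ 2) + x i ^ 2) * r) := by
    intro i; funext r
    simp only [Function.comp_apply, hg, sum_rayVec_mul_sq, neg_mul]
  have hint : ∀ i, Integrable g (Measure.map (rayVec i) (volume.restrict (Ioi (0:ℝ)))) := by
    intro i
    rw [integrable_map_measure hgc.aestronglyMeasurable (measurable_rayVec i).aemeasurable, hcomp i]
    exact exp_neg_integrableOn_Ioi 0 (denom_pos hx i)
  refine ⟨integrable_finsetSum_measure.2 fun i _ => hint i, ?_⟩
  rw [gsmMeasure, integral_finsetSum_measure fun i _ => hint i]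
  unfold threeAtomKernel
  refine Finset.sum_congr rfl fun i _ => ?_
  rw [integral_map (measurable_rayVec i).aemeasurable hgc.aestronglyMeasurable]
  have := integral_exp_neg_mul_Ioi (denom_pos hx i)
  rw [← this]
  refine integral_congr_ae (Filter.Eventually.of_forall fun r => ?_)
  have h := congrFun (hcomp i) r
  simp only [Function.comp_apply] at h
  simp only [h, neg_mul]

/-! ## (a) Load-bearing analysis: the RP conjunct -/

/-- The crux with the reflection-positivity conjunct DROPPED (nine mirror invariances, window,
continuity, positivity, homogeneity and the GSM representation kept). -/
def GSMRigidityWithoutRP : Prop :=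
  ∀ (Δ : ℝ) (K : E3 → ℝ), 1/2 ≤ Δ → Δ ≤ 1 → ContinuousOn K {0}ᶜ → (∀ x, x ≠ 0 → 0 < K x) →
    (∀ c : ℝ, 0 < c → ∀ x, K (c • x) = c ^ (-(2 * Δ)) * K x) →
    (∀ n : E3, NineNormal n → ∀ x, K (((ℝ ∙ n)ᗮ).reflection x) = K x) →
    IsGSM K → ∀ (R : E3 ≃ₗᵢ[ℝ] E3) (x : E3), K (R x) = K x

/-- The variant is the crux minus one hypothesis. -/
theorem withoutRP_imp_crux (h : GSMRigidityWithoutRP) :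
    Summit.CriticalPhenomena.Ising3DConformalLimit.Theses.GaussianScaleMixture.GSMRigidity := by
  rw [gsmRigidity_iff]
  intro Δ K h1 h2 hc hpos hhom hnine hgsm R x
  exact h Δ K h1 h2 hc hpos hhom (fun n hn => (hnine n hn).1) hgsm R x

/-- **LOAD-BEARING: any proof of `GSMRigidity` must use reflection positivity.** The exchangeable
three-atom Gaussian scale mixture `Σᵢ 1/(‖x‖² + xᵢ²)` satisfies every other hypothesis at `Δ = 1`
and is anisotropic: `K e₀ = 5/2`, `K (θ_{(1,1,1)} e₀) = 297/130`. -/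
theorem gsmRigidity_false_without_RP : ¬ GSMRigidityWithoutRP := by
  intro h
  have key := h 1 threeAtomKernel (by norm_num) le_rfl threeAtomKernel_continuousOn
    (fun x hx => threeAtomKernel_pos hx) (fun c hc x => threeAtomKernel_smul hc x)
    (fun n hn x => threeAtomKernel_reflection n hn x) threeAtomKernel_isGSM
    ((ℝ ∙ v111)ᗮ.reflection) (EuclideanSpace.single 0 1)
  rw [threeAtomKernel_reflection_v111_e0, threeAtomKernel_e0] at key
  norm_num at key

/-! ## (c) Which RP kills the witness: the diagonal (swap) mirror — an exact 4-point certificate -/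

/-- points in the plane `x₃ = 0` -/
def mk (a b : ℝ) : E3 := EuclideanSpace.single 0 a + EuclideanSpace.single 1 b

@[simp] theorem mk_apply_zero (a b : ℝ) : mk a b 0 = a := by simp [mk]
@[simp] theorem mk_apply_one (a b : ℝ) : mk a b 1 = b := by simp [mk]
@[simp] theorem mk_apply_two (a b : ℝ) : mk a b 2 = 0 := by simp [mk]

/-- the swap normal `e₀ - e₁` -/
def nSwap : E3 := EuclideanSpace.single 0 1 - EuclideanSpace.single 1 1

theorem inner_mk_nSwap (a b : ℝ) : inner ℝ (mk a b) nSwap = a - b := by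
  rw [real_inner_comm, nSwap, inner_single_sub_single_left, mk_apply_zero, mk_apply_one]

theorem reflection_nSwap_mk (a b : ℝ) : (ℝ ∙ nSwap)ᗮ.reflection (mk a b) = mk b a := by
  ext l
  rw [nSwap, reflection_single_sub_single_apply (by decide : (0 : Fin 3) ≠ 1)]
  fin_cases l <;> simp [Equiv.swap_apply_left, Equiv.swap_apply_right,
    Equiv.swap_apply_of_ne_of_ne]

theorem mk_sub_mk (a b c d : ℝ) : mk a b - mk c d = mk (a - c) (b - d) := by
  ext l
  fin_cases l <;> simp

theorem threeAtomKernel_mk (u v : ℝ) :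
    threeAtomKernel (mk u v) = 1 / (2 * u ^ 2 + v ^ 2) + 1 / (u ^ 2 + 2 * v ^ 2) + 1 / (u ^ 2 + v ^ 2) := by
  unfold threeAtomKernel
  simp only [Fin.sum_univ_three, mk_apply_zero, mk_apply_one, mk_apply_two]
  ring_nf

/-- **The three-atom GSM kernel is NOT reflection positive for the swap mirror `x₁ = x₂`.**
Points `(3,-3,0), (4,-2,0), (5,-1,0), (6,0,0)` (all in the open half-space `x₁ - x₂ = 6 > 0`),
coefficients `(5,-14,14,-5)`: the RP quadratic form equals `-3305/17120862 < 0`. The differences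
`p_a - θ p_b` are `(6+d, d-6, 0)`, `d = a - b`, with `K(6+d,d-6,0) = 1/(S+(6+d)²)+1/(S+(6-d)²)+1/S`,
`S = 72 + 2d²`: `7/216, 9535/300366, 43/1440, 509/18810` for `|d| = 0,1,2,3`. -/
theorem threeAtomKernel_not_swapRP : ¬ RPForm nSwap threeAtomKernel := by
  intro h
  have key := h 4 ![mk 3 (-3), mk 4 (-2), mk 5 (-1), mk 6 0] ![5, -14, 14, -5] (by
    intro a
    fin_cases a <;> simp [inner_mk_nSwap] <;> norm_num)
  simp only [Fin.sum_univ_four, Matrix.cons_val_zero, Matrix.cons_val_one, Matrix.cons_val,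
    reflection_nSwap_mk, mk_sub_mk, threeAtomKernel_mk] at key
  norm_num at key

/-! ## (b) Tools for the positive side (F3) -/

/-- **Circle lemma (F3 step 2), algebraic core.** On the transverse momentum `q = k (e₁+e₂)/√2`
(`k₃ = 0`) the swap pencil of the atom `ω` factors as `a_ω (t² - 2ρ_ω k t + k²)` with
`a_ω = (1/ω₁ + 1/ω₂)/2`, `ρ_ω = (ω₁ - ω₂)/(ω₁ + ω₂)`: by Vieta the two complex roots have product `k²`,
i.e. they lie ON the circle `|t| = k`, whatever `ω` is. -/
theorem swapSlice_factor {ω₁ ω₂ : ℝ} (h₁ : 0 < ω₁) (h₂ : 0 < ω₂) (k t : ℝ) :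
    (1 / ω₁ + 1 / ω₂) / 2 * t ^ 2 + (1 / ω₁ - 1 / ω₂) * (k * t) + (1 / ω₁ + 1 / ω₂) / 2 * k ^ 2 =
      (1 / ω₁ + 1 / ω₂) / 2 * (t ^ 2 - 2 * ((ω₁ - ω₂) / (ω₁ + ω₂)) * (k * t) + k ^ 2) := by
  have h12 : ω₁ + ω₂ ≠ 0 := by positivity
  field_simp
  ring

/-- `|ρ_ω| < 1` on the open simplex: the roots `k e^{±iθ_ω}`, `cos θ_ω = ρ_ω`, are honestly complex
(off the real axis) for every atom, and real (`θ = 0, π`) only in the closure `ω₂/ω₁ → 0, ∞`. -/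
theorem swapSlice_rho_abs_lt_one {ω₁ ω₂ : ℝ} (h₁ : 0 < ω₁) (h₂ : 0 < ω₂) :
    |(ω₁ - ω₂) / (ω₁ + ω₂)| < 1 := by
  rw [abs_div, abs_of_pos (by positivity : 0 < ω₁ + ω₂), div_lt_one (by positivity)]
  exact abs_sub_lt_iff.2 ⟨by linarith, by linarith⟩

/-- `ρ_ω = 0 ↔ ω₁ = ω₂`: the pencil singularities sit at `±i k` (on the Stieltjes cut) exactly for the
swap-symmetric atoms. -/
theorem swapSlice_rho_eq_zero_iff {ω₁ ω₂ : ℝ} (h₁ : 0 < ω₁) (h₂ : 0 < ω₂) :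
    (ω₁ - ω₂) / (ω₁ + ω₂) = 0 ↔ ω₁ = ω₂ := by
  rw [div_eq_zero_iff, sub_eq_zero]
  constructor
  · rintro (h | h)
    · exact h
    · linarith
  · exact fun h => Or.inl h

/-- **Phase lemma (F3 step 3): the base of the arc jump has a `θ`-independent argument.**
`(e^{iφ} - e^{iθ})(e^{iφ} - e^{-iθ}) = 2 (cos φ - cos θ) e^{iφ}`: for `θ < φ` the base is a NEGATIVE real
multiple of `e^{iφ}`, whence the inside boundary value of every atom `((t-e^{iθ})(t-e^{-iθ}))^{-p}` at
`t = e^{iφ}` is `e^{-ipχ(φ)} (2(cos θ - cos φ))^{-p}` with ONE phase `χ(φ)` for all `θ < φ` — the jump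
integrand has a sign. -/
theorem arcBase_eq (θ φ : ℝ) :
    (Complex.exp (φ * Complex.I) - Complex.exp (θ * Complex.I)) *
        (Complex.exp (φ * Complex.I) - Complex.exp (-(θ * Complex.I))) =
      2 * ((Real.cos φ : ℂ) - Real.cos θ) * Complex.exp (φ * Complex.I) := by
  have hθ : Complex.exp (θ * Complex.I) * Complex.exp (-(θ * Complex.I)) = 1 := by
    rw [← Complex.exp_add, add_neg_cancel, Complex.exp_zero]
  have hφ : Complex.exp (-(φ * Complex.I)) * Complex.exp (φ * Complex.I) = 1 := by
    rw [← Complex.exp_add, neg_add_cancel, Complex.exp_zero]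
  have cφ : (2 : ℂ) * Real.cos φ = Complex.exp (φ * Complex.I) + Complex.exp (-(φ * Complex.I)) := by
    rw [Complex.ofReal_cos, Complex.two_cos, neg_mul]
  have cθ : (2 : ℂ) * Real.cos θ = Complex.exp (θ * Complex.I) + Complex.exp (-(θ * Complex.I)) := by
    rw [Complex.ofReal_cos, Complex.two_cos, neg_mul]
  have h2 : 2 * ((Real.cos φ : ℂ) - Real.cos θ) =
      (Complex.exp (φ * Complex.I) + Complex.exp (-(φ * Complex.I))) -
        (Complex.exp (θ * Complex.I) + Complex.exp (-(θ * Complex.I))) := by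
    rw [mul_sub, cφ, cθ]
  rw [h2]
  linear_combination hθ - hφ

/-- Real form of the phase lemma on the arc: `e^{2iφ} - 2 cos θ e^{iφ} + 1 = 2(cos φ - cos θ) e^{iφ}`,
and `cos φ - cos θ < 0` for `0 < θ < φ ≤ π` (`jumpIntegrand_pos`). -/
theorem arcBase_eq' (θ φ : ℝ) :
    Complex.exp (φ * Complex.I) ^ 2 - 2 * Real.cos θ * Complex.exp (φ * Complex.I) + 1 =
      2 * ((Real.cos φ : ℂ) - Real.cos θ) * Complex.exp (φ * Complex.I) := by
  rw [← arcBase_eq]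
  have hθ : Complex.exp (θ * Complex.I) * Complex.exp (-(θ * Complex.I)) = 1 := by
    rw [← Complex.exp_add, add_neg_cancel, Complex.exp_zero]
  have cθ : (2 : ℂ) * Real.cos θ = Complex.exp (θ * Complex.I) + Complex.exp (-(θ * Complex.I)) := by
    rw [Complex.ofReal_cos, Complex.two_cos, neg_mul]
  linear_combination (-(Complex.exp (φ * Complex.I))) * cθ - hθ

/-- Positivity of the jump integrand (F3 step 3/4): for `0 < θ < φ ≤ π`, `cos θ - cos φ > 0`, hence
`(cos θ - cos φ)^(-p) > 0`. -/
theorem jumpIntegrand_pos {θ φ : ℝ} (hθ : 0 < θ) (hθφ : θ < φ) (hφ : φ ≤ Real.pi) (p : ℝ) :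
    0 < (Real.cos θ - Real.cos φ) ^ (-p) :=
  Real.rpow_pos_of_pos (sub_pos.2 (Real.cos_lt_cos_of_nonneg_of_le_pi hθ.le hφ hθφ)) _

/-- One vanishing arc-jump at angle `φ ∈ (0, π]` already empties `(0, φ)`. -/
theorem measure_Ioo_eq_zero_of_jump_eq_zero {G : Measure ℝ} {p φ : ℝ} (hφ0 : 0 < φ)
    (hφπ : φ ≤ Real.pi)
    (h : ∫⁻ θ in Ioo 0 φ, ENNReal.ofReal ((Real.cos θ - Real.cos φ) ^ (-p)) ∂G = 0) :
    G (Ioo 0 φ) = 0 := by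
  have _ := hφ0
  have hmeas : Measurable fun θ => ENNReal.ofReal ((Real.cos θ - Real.cos φ) ^ (-p)) :=
    ((Real.measurable_cos.sub measurable_const).pow_const _).ennreal_ofReal
  have hae := (setLIntegral_eq_zero_iff measurableSet_Ioo hmeas).1 h
  rw [ae_iff] at hae
  refine measure_mono_null (fun θ hθ => ?_) hae
  simp only [Set.mem_setOf_eq]
  intro himp
  have hpos := jumpIntegrand_pos hθ.1 hθ.2 hφπ p
  exact (ENNReal.ofReal_pos.2 hpos).ne' (himp hθ)

/-- **Jump positivity, sharp form (F3 step 4).** It suffices that the arc-jumps vanish on a set `D`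
of angles accumulating at `π/2` from below (the paper proof gets them for Lebesgue-a.e. `φ` only,
see `jump_positivity_ae`). -/
theorem jump_positivity_of_frequently {G : Measure ℝ} {p : ℝ} {D : Set ℝ}
    (hD : D ⊆ Ioo 0 (Real.pi / 2)) (hsup : ∀ ε > 0, ∃ φ ∈ D, Real.pi / 2 - ε < φ)
    (h : ∀ φ ∈ D, ∫⁻ θ in Ioo 0 φ, ENNReal.ofReal ((Real.cos θ - Real.cos φ) ^ (-p)) ∂G = 0) :
    G (Ioo 0 (Real.pi / 2)) = 0 := by
  have hφ : ∀ φ ∈ D, G (Ioo 0 φ) = 0 := fun φ hφD =>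
    measure_Ioo_eq_zero_of_jump_eq_zero (hD hφD).1 (by linarith [(hD hφD).2, Real.pi_pos]) (h φ hφD)
  choose φ hφD hφlt using fun n : ℕ => hsup (1 / ((n : ℝ) + 1)) (by positivity)
  have hcover : Ioo 0 (Real.pi / 2) ⊆ ⋃ n : ℕ, Ioo 0 (φ n) := by
    intro x hx
    obtain ⟨n, hn⟩ := exists_nat_one_div_lt (sub_pos.2 hx.2)
    exact Set.mem_iUnion.2 ⟨n, hx.1, by linarith [hφlt n]⟩
  exact measure_mono_null hcover (measure_iUnion_null fun n => hφ _ (hφD n))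

/-- **Jump positivity, a.e. form (exactly what F3 step 3 delivers).** If the arc-jump vanishes for
Lebesgue-a.e. `φ ∈ (0, π/2)` then `G (0, π/2) = 0`. -/
theorem jump_positivity_ae {G : Measure ℝ} {p : ℝ}
    (h : ∀ᵐ φ ∂(volume : Measure ℝ), φ ∈ Ioo 0 (Real.pi / 2) →
      ∫⁻ θ in Ioo 0 φ, ENNReal.ofReal ((Real.cos θ - Real.cos φ) ^ (-p)) ∂G = 0) :
    G (Ioo 0 (Real.pi / 2)) = 0 := by
  set D : Set ℝ := {φ | φ ∈ Ioo 0 (Real.pi / 2) ∧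
    ∫⁻ θ in Ioo 0 φ, ENNReal.ofReal ((Real.cos θ - Real.cos φ) ^ (-p)) ∂G = 0} with hDdef
  refine jump_positivity_of_frequently (D := D) (fun φ hφ => hφ.1) ?_ (fun φ hφ => hφ.2)
  intro ε hε
  by_contra hne
  push Not at hne
  -- the interval (π/2 - ε', π/2), ε' = min ε (π/2), would lie in the null exceptional set
  set ε' : ℝ := min ε (Real.pi / 2) with hε'
  have hε'pos : 0 < ε' := lt_min hε (by positivity)
  have hε'le : ε' ≤ ε := min_le_left _ _
  have hε'le' : ε' ≤ Real.pi / 2 := min_le_right _ _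
  rw [ae_iff] at h
  have hsub : Ioo (Real.pi / 2 - ε') (Real.pi / 2) ⊆
      {φ | ¬ (φ ∈ Ioo 0 (Real.pi / 2) →
        ∫⁻ θ in Ioo 0 φ, ENNReal.ofReal ((Real.cos θ - Real.cos φ) ^ (-p)) ∂G = 0)} := by
    intro φ hφ
    simp only [Set.mem_setOf_eq]
    intro himp
    have hφI : φ ∈ Ioo 0 (Real.pi / 2) := ⟨by linarith [hφ.1], hφ.2⟩
    have hφD : φ ∈ D := ⟨hφI, himp hφI⟩
    have := hne φ hφD
    linarith [hφ.1]
  have hnull := measure_mono_null hsub h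
  rw [Real.volume_Ioo] at hnull
  have : (0 : ENNReal) < ENNReal.ofReal (Real.pi / 2 - (Real.pi / 2 - ε')) :=
    ENNReal.ofReal_pos.2 (by linarith)
  exact this.ne' hnull

/-- **Jump positivity (F3 step 4, the punchline).** If a measure `G` on `ℝ` (the push-forward of
`c_ω a_ω^{-p} Φ` to the angle `θ_ω = arccos ρ_ω`) has vanishing arc-jumps
`∫⁻_{(0,φ)} (cos θ - cos φ)^{-p} dG(θ) = 0` for every `φ ∈ (0, π/2)`, then `G (0, π/2) = 0` — i.e.
`Φ{ω₁ > ω₂} = 0`. No cancellation is possible because the integrand is positive. -/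
theorem jump_positivity {G : Measure ℝ} {p : ℝ}
    (h : ∀ φ ∈ Ioo 0 (Real.pi / 2),
      ∫⁻ θ in Ioo 0 φ, ENNReal.ofReal ((Real.cos θ - Real.cos φ) ^ (-p)) ∂G = 0) :
    G (Ioo 0 (Real.pi / 2)) = 0 := by
  refine jump_positivity_of_frequently (D := Ioo 0 (Real.pi / 2)) subset_rfl (fun ε hε => ?_) h
  refine ⟨Real.pi / 2 - min ε (Real.pi / 2) / 2, ⟨?_, ?_⟩, ?_⟩
  · have : min ε (Real.pi / 2) ≤ Real.pi / 2 := min_le_right _ _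
    linarith [Real.pi_pos]
  · have : 0 < min ε (Real.pi / 2) := lt_min hε (by positivity)
    linarith
  · have : min ε (Real.pi / 2) ≤ ε := min_le_left _ _
    have : 0 < min ε (Real.pi / 2) := lt_min hε (by positivity)
    linarith

/-! ## The two statements F3 splits the crux into (for planners / provers; no sorry, Props only) -/

/-- **Swap-pencil dictionary (F2), the analytic input.** For a finite measure `Φ` on the open simplex
with `∫ ωᵢ^{-Δ} dΦ < ∞` whose kernel `K = Γ(Δ)∫(ω·x²)^{-Δ}dΦ` is swap-RP (`RPForm nSwap K`), the special
pencil `f(t) = ∫ c_ω a_ω^{-p} (t² - 2ρ_ω t + 1)^{-p} dΦ(ω)` (`p = 3/2 - Δ`) is the restriction to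
`(0,1) ∪ (1,∞)` of a function analytic on `ℂ ∖ {iy : |y| ≥ 1}`. Stated here measure-free on the
push-forward `G` (symmetric finite measure on `(0,π)`): this is what Steps 1–2 of F3 deliver. -/
def SwapPencilAnalytic (G : Measure ℝ) (p : ℝ) : Prop :=
  ∃ F : ℂ → ℂ, DifferentiableOn ℂ F {z : ℂ | ¬ (z.re = 0 ∧ 1 ≤ |z.im|)} ∧
    ∀ t : ℝ, 0 < t → t ≠ 1 →
      F t = ((∫ θ in Ioo 0 Real.pi, (t ^ 2 - 2 * t * Real.cos θ + 1) ^ (-p) ∂G : ℝ) : ℂ)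

/-- **Slice rigidity (F3 Steps 3–4), the statement a prover should close first** (one complex
variable, no physics): a finite positive measure `G` on `(0,π)` whose Gegenbauer-type transform
`t ↦ ∫(t² - 2t cos θ + 1)^{-p} dG(θ)`, `0 < p < 1`, extends analytically across the open unit
upper-right arc, charges no angle in `(0, π/2)`. Proof: F3 Step 3 (monodromy jump
`(e^{2πip}-1)e^{-ipχ}2^{-p}∫_{(0,φ)}(cos θ - cos φ)^{-p}dG`) + `jump_positivity`. -/
def SliceRigidity (p : ℝ) : Prop :=
  ∀ G : Measure ℝ, IsFiniteMeasure G → G (Ioo 0 Real.pi)ᶜ = 0 →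
    SwapPencilAnalytic G p → G (Ioo 0 (Real.pi / 2)) = 0


/-! ## Cycle 2 (c′): finite sums of inverse quadrics are Gaussian scale mixtures;
## the planner's CHEAPEST-FALSIFIER family, certified non-swap-RP at `Δ = 1` -/

/-- A positive diagonal quadratic form is positive off the origin. -/
theorem quadForm_pos {w : Fin 3 → ℝ} (hw : ∀ j, 0 < w j) {x : E3} (hx : x ≠ 0) :
    0 < ∑ j, w j * x j ^ 2 := by
  obtain ⟨i, hi⟩ := exists_coord_ne_zero hx
  exact Finset.sum_pos' (fun j _ => mul_nonneg (hw j).le (sq_nonneg _))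
    ⟨i, Finset.mem_univ _, mul_pos (hw i) (by positivity)⟩

/-- `Σ_t 1/(w_t · x²)`: a finite sum of inverse diagonal quadrics (`Δ = 1` atoms of the simplex form,
up to the factor `Γ(1) = 1` and the normalisation of `w_t`). -/
def quadricSum {N : ℕ} (w : Fin N → Fin 3 → ℝ) (x : E3) : ℝ := ∑ t, 1 / (∑ j, w t j * x j ^ 2)

/-- the ray `r ↦ r • w` in the closed octant -/
def rayOf (w : Fin 3 → ℝ) (r : ℝ) : Fin 3 → ℝ := fun j => r * w j

theorem measurable_rayOf (w : Fin 3 → ℝ) : Measurable (rayOf w) :=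
  measurable_pi_lambda _ fun _ => measurable_id.mul_const _

/-- `ν_w = Σ_t (rayOf w_t)_* (Lebesgue on (0,∞))` -/
def quadricSumMeasure {N : ℕ} (w : Fin N → Fin 3 → ℝ) : Measure (Fin 3 → ℝ) :=
  ∑ t, Measure.map (rayOf (w t)) (volume.restrict (Ioi (0:ℝ)))

theorem quadricSumMeasure_negSet {N : ℕ} (w : Fin N → Fin 3 → ℝ) (hw : ∀ t j, 0 < w t j) :
    quadricSumMeasure w {s | ∃ i, s i < 0} = 0 := by
  rw [quadricSumMeasure, Measure.finsetSum_apply]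
  refine Finset.sum_eq_zero fun t _ => ?_
  rw [Measure.map_apply (measurable_rayOf _) measurableSet_negSet,
    Measure.restrict_apply' measurableSet_Ioi]
  have : rayOf (w t) ⁻¹' {s : Fin 3 → ℝ | ∃ i, s i < 0} ∩ Ioi 0 = ∅ := by
    ext r
    simp only [Set.mem_inter_iff, Set.mem_preimage, Set.mem_setOf_eq, Set.mem_Ioi,
      Set.mem_empty_iff_false, iff_false, not_and, forall_exists_index]
    intro j hj hr
    have : 0 < rayOf (w t) r j := mul_pos hr (hw t j)
    linarith
  rw [this, measure_empty]

theorem sum_rayOf_mul_sq (w : Fin 3 → ℝ) (x : E3) (r : ℝ) :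
    ∑ j, rayOf w r j * x j ^ 2 = (∑ j, w j * x j ^ 2) * r := by
  rw [Finset.sum_mul]
  exact Finset.sum_congr rfl fun j _ => by simp only [rayOf]; ring

/-- **Every finite positive sum of inverse diagonal quadrics is a Gaussian scale mixture in the
sense of the crux** (`1/L = ∫₀^∞ e^{-rL} dr`, an honest measure on `Fin 3 → ℝ` carried by `N` rays of
the closed octant). In particular the planner's falsifier family and the three-atom kernel are. -/
theorem quadricSum_isGSM {N : ℕ} (w : Fin N → Fin 3 → ℝ) (hw : ∀ t j, 0 < w t j) :
    IsGSM (quadricSum w) := by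
  refine ⟨quadricSumMeasure w, quadricSumMeasure_negSet w hw, fun x hx => ?_⟩
  set g : (Fin 3 → ℝ) → ℝ := fun s => Real.exp (-∑ i, s i * (x i) ^ 2) with hg
  have hgc : Continuous g := continuous_gaussIntegrand x
  have hcomp : ∀ t, g ∘ rayOf (w t) = fun r => Real.exp (-(∑ j, w t j * x j ^ 2) * r) := by
    intro t; funext r
    simp only [Function.comp_apply, hg, sum_rayOf_mul_sq, neg_mul]
  have hint : ∀ t, Integrable g (Measure.map (rayOf (w t)) (volume.restrict (Ioi (0:ℝ)))) := by
    intro t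
    rw [integrable_map_measure hgc.aestronglyMeasurable (measurable_rayOf _).aemeasurable, hcomp t]
    exact exp_neg_integrableOn_Ioi 0 (quadForm_pos (hw t) hx)
  refine ⟨integrable_finsetSum_measure.2 fun t _ => hint t, ?_⟩
  rw [quadricSumMeasure, integral_finsetSum_measure fun t _ => hint t]
  unfold quadricSum
  refine Finset.sum_congr rfl fun t _ => ?_
  rw [integral_map (measurable_rayOf _).aemeasurable hgc.aestronglyMeasurable,
    ← integral_exp_neg_mul_Ioi (quadForm_pos (hw t) hx)]
  refine integral_congr_ae (Filter.Eventually.of_forall fun r => ?_)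
  have h := congrFun (hcomp t) r
  simp only [Function.comp_apply] at h
  simp only [h, neg_mul]

theorem quadricSum_pos {N : ℕ} [NeZero N] (w : Fin N → Fin 3 → ℝ) (hw : ∀ t j, 0 < w t j) {x : E3}
    (hx : x ≠ 0) : 0 < quadricSum w x :=
  Finset.sum_pos (fun t _ => one_div_pos.2 (quadForm_pos (hw t) hx)) Finset.univ_nonempty

/-- Weights of the planner's CHEAPEST-FALSIFIER family (route file, "Cheapest falsifier"): the six
permutations of `(1+ε, 1-ε, 1)` (the simplex normalisation `/3` is dropped — a positive constant
factor `3^Δ` on the kernel, irrelevant for reflection positivity). -/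
def plannerWeights (ε : ℝ) : Fin 6 → Fin 3 → ℝ :=
  ![![1 + ε, 1 - ε, 1], ![1 - ε, 1 + ε, 1], ![1 + ε, 1, 1 - ε], ![1 - ε, 1, 1 + ε],
    ![1, 1 + ε, 1 - ε], ![1, 1 - ε, 1 + ε]]

theorem plannerWeights_pos {ε : ℝ} (hε : |ε| < 1) (t : Fin 6) (j : Fin 3) :
    0 < plannerWeights ε t j := by
  have h1 : 0 < 1 + ε := by linarith [(abs_lt.1 hε).1]
  have h2 : 0 < 1 - ε := by linarith [(abs_lt.1 hε).2]
  fin_cases t <;> fin_cases j <;> simp [plannerWeights, h1, h2]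

/-- The planner's falsifier family at `Δ = 1`: `k_ε(x) = Σ_{σ ∈ S₃} 1/(ω_σ · x²)`, `ω = (1+ε, 1-ε, 1)`.
`B₃`-invariant by construction, continuous and positive off the origin, homogeneous of degree `-2`,
and a Gaussian scale mixture (`plannerKernel_isGSM`); round iff `ε = 0`. -/
def plannerKernel (ε : ℝ) (x : E3) : ℝ := quadricSum (plannerWeights ε) x

theorem plannerKernel_isGSM {ε : ℝ} (hε : |ε| < 1) : IsGSM (plannerKernel ε) :=
  quadricSum_isGSM _ (plannerWeights_pos hε)

theorem plannerKernel_pos {ε : ℝ} (hε : |ε| < 1) {x : E3} (hx : x ≠ 0) : 0 < plannerKernel ε x :=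
  quadricSum_pos _ (plannerWeights_pos hε) hx

theorem plannerKernel_mk (ε u v : ℝ) : plannerKernel ε (mk u v) =
    1 / ((1 + ε) * u ^ 2 + (1 - ε) * v ^ 2) + 1 / ((1 - ε) * u ^ 2 + (1 + ε) * v ^ 2) +
    1 / ((1 + ε) * u ^ 2 + v ^ 2) + 1 / ((1 - ε) * u ^ 2 + v ^ 2) +
    1 / (u ^ 2 + (1 + ε) * v ^ 2) + 1 / (u ^ 2 + (1 - ε) * v ^ 2) := by
  simp [plannerKernel, quadricSum, plannerWeights, Fin.sum_univ_succ, mk_apply_zero, mk_apply_one,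
    mk_apply_two]
  ring

/-- **The planner's falsifier family is not swap-RP at `ε = 1/2` (`Δ = 1`): a THREE-point
certificate** — points `(2,-2,0), (3,-1,0), (4,0,0)` on a line parallel to the mirror `x₁ = x₂`,
coefficients the plain second difference `(1,-2,1)`; the RP form is the fourth central difference of
`d ↦ k(4+d, d-4, 0)` and equals `-2764183781/1735113259880 < 0` (exact, `num/cert_verify.py`). -/
theorem plannerKernel_half_not_swapRP : ¬ RPForm nSwap (plannerKernel (1 / 2)) := by
  intro h
  have key := h 3 ![mk 2 (-2), mk 3 (-1), mk 4 0] ![1, -2, 1] (by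
    intro a
    fin_cases a <;> norm_num [inner_mk_nSwap])
  simp only [Fin.sum_univ_three, Matrix.cons_val_zero, Matrix.cons_val_one, Matrix.cons_val,
    reflection_nSwap_mk, mk_sub_mk, plannerKernel_mk] at key
  norm_num at key

/-- **The planner's falsifier family is not swap-RP at `ε = 1/5` (`Δ = 1`): a SEVEN-point
certificate** — points `(6+a, a-6, 0)`, `a = 0,…,6`, coefficients the plain sixth difference
`(1,-6,15,-20,15,-6,1)`; the RP form is the twelfth central difference of `d ↦ k(12+d, d-12, 0)`,
`≈ -1.715·10⁻⁸ < 0` exactly (a 50-digit over 58-digit rational, `num/cert_verify.py`). Smaller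
anisotropy needs longer alternating chains: exactly (rational arithmetic, `num/binomial_table.py`) the
minimal order `n` of a pure finite-difference certificate is `n = 2,3,3,4,5,6,7,8,10,12` for
`ε = 1/2, 2/5, 1/3, 3/10, 1/4, 1/5, 1/6, 1/7, 1/8, 1/10`, i.e. `n ≈ 1.2/ε`, with relative size decaying
like `e^{-c/ε}` (`-1.4·10⁻³` at `ε = 1/2`, `-3·10⁻²²` at `ε = 1/10`) — the finite shadow of F10. -/
theorem plannerKernel_fifth_not_swapRP : ¬ RPForm nSwap (plannerKernel (1 / 5)) := by
  intro h
  have key := h 7 ![mk 6 (-6), mk 7 (-5), mk 8 (-4), mk 9 (-3), mk 10 (-2), mk 11 (-1), mk 12 0]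
    ![1, -6, 15, -20, 15, -6, 1] (by
    intro a
    fin_cases a <;> norm_num [inner_mk_nSwap])
  simp only [Fin.sum_univ_seven, Matrix.cons_val_zero, Matrix.cons_val_one, Matrix.cons_val,
    reflection_nSwap_mk, mk_sub_mk, plannerKernel_mk] at key
  norm_num at key

/-! ## Cycle 2 (b′): two structural remarks used by the audit F8 -/

/-- **No circle lemma off the plane `k_w = 0`.** At transverse momentum `(k, k_w)` the swap pencil of
the atom `ω` is `a_ω (t² - 2ρ_ω k t + k² + k_w² τ_ω)` with `τ_ω = 2ω₁ω₂/((ω₁+ω₂)ω₃)`: the root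
product `k² + k_w² τ_ω` DEPENDS on `ω` unless `k_w = 0` — so the singularities of different atoms lie
on different circles, inside/outside gluing says nothing, and the proof F3 must first reach the
pencil `k_w = 0` (Montel, or F9(i)). -/
theorem swapSlice_factor_offplane {ω₁ ω₂ ω₃ : ℝ} (h₁ : 0 < ω₁) (h₂ : 0 < ω₂) (h₃ : 0 < ω₃)
    (k kw t : ℝ) :
    (1 / ω₁ + 1 / ω₂) / 2 * t ^ 2 + (1 / ω₁ - 1 / ω₂) * (k * t) + (1 / ω₁ + 1 / ω₂) / 2 * k ^ 2 +
        kw ^ 2 / ω₃ =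
      (1 / ω₁ + 1 / ω₂) / 2 *
        (t ^ 2 - 2 * ((ω₁ - ω₂) / (ω₁ + ω₂)) * (k * t) +
          (k ^ 2 + kw ^ 2 * (2 * ω₁ * ω₂ / ((ω₁ + ω₂) * ω₃)))) := by
  have h12 : ω₁ + ω₂ ≠ 0 := by positivity
  have h1 : ω₁ ≠ 0 := h₁.ne'
  have h2 : ω₂ ≠ 0 := h₂.ne'
  have h3 : ω₃ ≠ 0 := h₃.ne'
  field_simp
  ring

/-- **The endpoint `Δ = 1/2` (`p = 1`)**, where the monodromy factor `e^{2πip} - 1` of F3 Step 3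
vanishes: the atom is then an honest POLE pair and the pencil is a Cauchy transform of a measure on the
unit circle, `1/((t-ζ)(t-ζ̄)) = (1/(t-ζ) - 1/(t-ζ̄))/(ζ-ζ̄)`, `ζ = e^{iθ}`, `ζ - ζ̄ = 2i sin θ ≠ 0`;
analytic continuation across the arc then kills the measure by the Plemelj–Sokhotski jump instead of
the monodromy jump (F8(ii)). -/
theorem atom_pOne_partialFraction (t ζ ζ' : ℂ) (hne : ζ ≠ ζ') (ht : t ≠ ζ) (ht' : t ≠ ζ') :
    1 / ((t - ζ) * (t - ζ')) = (1 / (t - ζ) - 1 / (t - ζ')) / (ζ - ζ') := by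
  have h1 : t - ζ ≠ 0 := sub_ne_zero.2 ht
  have h2 : t - ζ' ≠ 0 := sub_ne_zero.2 ht'
  have h3 : ζ - ζ' ≠ 0 := sub_ne_zero.2 hne
  field_simp
  ring

/-! ## Cycle 3 (seat g3): homogeneity (massive circle lemma), stub tightness, lever signs -/

section Cycle3

open Filter Literature.Analysis.SpecialFunctions
open scoped Topology

/-! ### (a″) Load-bearing analysis continued: HOMOGENEITY -/

/-- **No circle lemma for MASSIVE atoms — where F3 uses homogeneity (F12).** On the transverse momentum
`q = k (e₁+e₂)/√2`, `k₃ = 0`, the swap pencil of a massive Gaussian-scale-mixture component of shape `ω`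
and mass `m` vanishes at the roots of `a_ω (t² - 2ρ_ω k t + k²) + m²`; by Vieta their product is
`k² + m² · 2ω₁ω₂/(ω₁+ω₂)`, which DEPENDS ON THE ATOM unless `m = 0`: massive components of different
shapes are singular on different circles and the inside/outside gluing of F3 Step 3 says nothing
(compare `swapSlice_factor_offplane`: `m²` plays the part of `k_w²/ω₃`). -/
theorem swapSlice_factor_massive {ω₁ ω₂ : ℝ} (h₁ : 0 < ω₁) (h₂ : 0 < ω₂) (k t m : ℝ) :
    (1 / ω₁ + 1 / ω₂) / 2 * t ^ 2 + (1 / ω₁ - 1 / ω₂) * (k * t) + (1 / ω₁ + 1 / ω₂) / 2 * k ^ 2 + m ^ 2 =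
      (1 / ω₁ + 1 / ω₂) / 2 *
        (t ^ 2 - 2 * ((ω₁ - ω₂) / (ω₁ + ω₂)) * (k * t) +
          (k ^ 2 + m ^ 2 * (2 * ω₁ * ω₂ / (ω₁ + ω₂)))) := by
  have h12 : ω₁ + ω₂ ≠ 0 := by positivity
  have h1 : ω₁ ≠ 0 := h₁.ne'
  have h2 : ω₂ ≠ 0 := h₂.ne'
  field_simp
  ring

/-- The crux with HOMOGENEITY dropped (continuity, positivity, the nine invariances and RPs and the GSM
representation kept; `Δ` disappears with the homogeneity clause). STATUS: OPEN (F12) — neither a witness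
nor a proof: F3's circle lemma fails for massive components (`swapSlice_factor_massive`), finite atomic
massive mixtures are nevertheless rigid (meromorphic/algebraic pencils with off-axis singularities), and a
diffuse massive anisotropy measure is undecided. Not needed by the route (limit kernels are homogeneous). -/
def GSMRigidityWithoutHomogeneity : Prop :=
  ∀ (K : E3 → ℝ), ContinuousOn K {0}ᶜ → (∀ x, x ≠ 0 → 0 < K x) →
    (∀ n : E3, NineNormal n → (∀ x, K (((ℝ ∙ n)ᗮ).reflection x) = K x) ∧ RPForm n K) →
    IsGSM K → ∀ (R : E3 ≃ₗᵢ[ℝ] E3) (x : E3), K (R x) = K x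

/-- The homogeneity-free variant implies the crux (it has fewer hypotheses). -/
theorem gsmRigidity_of_withoutHomogeneity (h : GSMRigidityWithoutHomogeneity) :
    Summit.CriticalPhenomena.Ising3DConformalLimit.Theses.GaussianScaleMixture.GSMRigidity := by
  rw [gsmRigidity_iff]
  intro _ K _ _ hc hpos _ hnine hgsm R x
  exact h K hc hpos hnine hgsm R x

/-! ### (b″) Identity theorem from the positive reals (the gluing step of x-side S2 / momentum S4) -/

/-- Two functions holomorphic on the open right half-plane that agree on the positive reals agree.
[folklore] -/
theorem eqOn_rhp_of_eqOn_ofReal {F G : ℂ → ℂ} (hF : DifferentiableOn ℂ F {t : ℂ | 0 < t.re})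
    (hG : DifferentiableOn ℂ G {t : ℂ | 0 < t.re}) (h : ∀ t : ℝ, 0 < t → F t = G t) :
    EqOn F G {t : ℂ | 0 < t.re} := by
  have hopen : IsOpen {t : ℂ | 0 < t.re} := isOpen_lt continuous_const Complex.continuous_re
  have hconn : IsPreconnected {t : ℂ | 0 < t.re} := (convex_halfSpace_re_gt 0).isPreconnected
  have hFa : AnalyticOnNhd ℂ F {t : ℂ | 0 < t.re} := hF.analyticOnNhd hopen
  have hGa : AnalyticOnNhd ℂ G {t : ℂ | 0 < t.re} := hG.analyticOnNhd hopen
  have h1 : (1 : ℂ) ∈ {t : ℂ | 0 < t.re} := by simp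
  refine hFa.eqOn_of_preconnected_of_frequently_eq hGa hconn h1 ?_
  have hu : Tendsto (fun n : ℕ => (((1 : ℝ) + 1 / ((n : ℝ) + 1) : ℝ) : ℂ)) atTop (𝓝[≠] (1 : ℂ)) := by
    rw [tendsto_nhdsWithin_iff]
    constructor
    · have h0 : Tendsto (fun n : ℕ => (1 : ℝ) + 1 / ((n : ℝ) + 1)) atTop (𝓝 1) := by
        simpa using (tendsto_one_div_add_atTop_nhds_zero_nat.const_add (1 : ℝ))
      have h1' := (Complex.continuous_ofReal.tendsto (1 : ℝ)).comp h0
      simpa [Function.comp_def] using h1'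
    · refine Eventually.of_forall fun n => ?_
      simp only [mem_compl_iff, mem_singleton_iff]
      intro heq
      have hre := congrArg Complex.re heq
      simp only [Complex.ofReal_re, Complex.one_re] at hre
      have : (0 : ℝ) < 1 / ((n : ℝ) + 1) := by positivity
      linarith
  refine hu.frequently (Frequently.of_forall fun n => ?_)
  exact h _ (by positivity)

/-! ### `-- Targets` (F11): stub hypotheses certified NECESSARY (no stub is false) -/

/-- **Tightness of stub `stub_stieltjesHalfPlane` (line `momentum-one-amplitude`, S4): `1 ≤ β` cannot be
weakened to `1/2 ≤ β`.** Witness `g s = (s + 1)⁻¹` (Stieltjes), `β = 1/2`, `M₀ = 1`: `g(r²) ≤ r^{-1/2}`,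
the only holomorphic `F` on `Re t > 0` with `F t = g(t²)` on the positive reals is `(t² + 1)⁻¹`
(`eqOn_rhp_of_eqOn_ofReal`), and at `t = 1/9 + i`: `‖F t‖ = 81/√325 > 3 = (Re t)^{-1/2}`. So for THIS
line the upper end `Δ ≤ 1` of the window (`β = 3 - 2Δ ≥ 1`) is load-bearing; F3 and the x-side line do
not use it (F4/F9(v)). -/
theorem stieltjesHalfPlane_false_at_beta_half :
    ¬ (∀ (g : ℝ → ℝ) (β M₀ : ℝ), IsStieltjesFunction g → 1 / 2 ≤ β →
      (∀ r : ℝ, 0 < r → g (r ^ 2) ≤ M₀ * r ^ (-β)) →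
      ∃ F : ℂ → ℂ, DifferentiableOn ℂ F {t : ℂ | 0 < t.re} ∧
        (∀ t : ℝ, 0 < t → F t = ((g (t ^ 2) : ℝ) : ℂ)) ∧
        ∀ t : ℂ, 0 < t.re → ‖F t‖ ≤ M₀ * t.re ^ (-β)) := by
  intro h
  have hg : IsStieltjesFunction (fun s : ℝ => (s + 1)⁻¹) := isStieltjesFunction_inv_add_const_of_pos one_pos
  have hdec : ∀ r : ℝ, 0 < r → (fun s : ℝ => (s + 1)⁻¹) (r ^ 2) ≤ 1 * r ^ (-(1 / 2 : ℝ)) := by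
    intro r hr
    simp only [one_mul]
    rw [Real.rpow_neg hr.le]
    have hsqrt_le : r ^ (1 / 2 : ℝ) ≤ r ^ 2 + 1 := by
      rcases le_or_gt r 1 with hr1 | hr1
      · have : r ^ (1 / 2 : ℝ) ≤ 1 := Real.rpow_le_one hr.le hr1 (by norm_num)
        nlinarith [sq_nonneg r]
      · have h1 : r ^ (1 / 2 : ℝ) ≤ r ^ (1 : ℝ) :=
          Real.rpow_le_rpow_of_exponent_le hr1.le (by norm_num)
        rw [Real.rpow_one] at h1
        nlinarith
    have hpos : 0 < r ^ (1 / 2 : ℝ) := Real.rpow_pos_of_pos hr _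
    exact inv_anti₀ hpos hsqrt_le
  obtain ⟨F, hF, hFreal, hFbound⟩ := h (fun s => (s + 1)⁻¹) (1 / 2) 1 hg le_rfl hdec
  -- the competitor `G t = (t² + 1)⁻¹`, holomorphic on the right half-plane
  set G : ℂ → ℂ := fun t => (t ^ 2 + 1)⁻¹ with hGdef
  have hne : ∀ t : ℂ, 0 < t.re → t ^ 2 + 1 ≠ 0 := by
    intro t ht h0
    have hre := congrArg Complex.re h0
    have him := congrArg Complex.im h0
    simp only [Complex.add_re, Complex.one_re, Complex.zero_re, Complex.add_im, Complex.one_im,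
      Complex.zero_im, add_zero, sq, Complex.mul_re, Complex.mul_im] at hre him
    have him' : 2 * t.re * t.im = 0 := by linarith
    rcases mul_eq_zero.1 him' with h2 | h2
    · have : t.re = 0 := by linarith
      linarith
    · rw [h2, mul_zero, sub_zero] at hre
      nlinarith
  have hG : DifferentiableOn ℂ G {t : ℂ | 0 < t.re} := by
    intro t ht
    have hd : DifferentiableAt ℂ (fun t : ℂ => t ^ 2 + 1) t := by fun_prop
    exact (hd.inv (hne t ht)).differentiableWithinAt
  have hFG : EqOn F G {t : ℂ | 0 < t.re} := by
    refine eqOn_rhp_of_eqOn_ofReal hF hG fun t ht => ?_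
    rw [hFreal t ht, hGdef]
    push_cast
    ring
  -- evaluate at `t₀ = 1/9 + i`
  set t₀ : ℂ := (1 / 9 : ℂ) + Complex.I with ht₀
  have ht₀re : t₀.re = 1 / 9 := by simp [ht₀]
  have ht₀mem : t₀ ∈ {t : ℂ | 0 < t.re} := by
    simp only [mem_setOf_eq, ht₀re]; norm_num
  have hsq : t₀ ^ 2 + 1 = ⟨1 / 81, 2 / 9⟩ := by
    apply Complex.ext <;> simp [ht₀, sq] <;> norm_num
  have hnorm : ‖t₀ ^ 2 + 1‖ < 1 / 3 := by
    rw [hsq, Complex.norm_def, Complex.normSq_mk]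
    rw [show (1 / 3 : ℝ) = Real.sqrt (1 / 9) by
      rw [show (1 / 9 : ℝ) = (1 / 3) ^ 2 by norm_num, Real.sqrt_sq (by norm_num)]]
    exact Real.sqrt_lt_sqrt (by positivity) (by norm_num)
  have hGbig : 3 < ‖G t₀‖ := by
    simp only [hGdef, norm_inv]
    have hpos : 0 < ‖t₀ ^ 2 + 1‖ := norm_pos_iff.2 (hne t₀ ht₀mem)
    rw [lt_inv_comm₀ (by norm_num) hpos]
    simpa using hnorm
  have hbound := hFbound t₀ ht₀mem
  rw [hFG ht₀mem, ht₀re, one_mul] at hbound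
  have hrpow : (1 / 9 : ℝ) ^ (-(1 / 2 : ℝ)) = 3 := by
    rw [Real.rpow_neg (by norm_num), one_div, Real.inv_rpow (by norm_num), inv_inv,
      show (9 : ℝ) = (3 : ℝ) ^ (2 : ℕ) by norm_num, ← Real.rpow_natCast,
      ← Real.rpow_mul (by norm_num)]
    norm_num
  rw [hrpow] at hbound
  linarith

/-- **Tightness of stub `stub_oneAmplitudeMomentum` (line `momentum-one-amplitude`, S5): EXCHANGEABILITY
of the mixing measure is load-bearing.** Drop it and the one-amplitude identity `D_ν(1,0) = D_ν(1/2,1/2)`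
no longer forces isotropy: `ν = δ_{(1,1,2)}`, `K x = exp(-(x₀² + x₁² + 2x₂²))` has equal dual
amplitudes at `e₀` and `(e₀+e₁)/√2` (the identity only sees `s₀ = s₁`) but `K(e₂) = e⁻² ≠ e⁻¹ = K(e₀)`. -/
theorem oneAmplitudeMomentum_false_without_exchangeability :
    ¬ (∀ (K : EuclideanSpace ℝ (Fin 3) → ℝ) (ν : Measure (Fin 3 → ℝ)),
      ν {s | ∃ i, s i ≤ 0} = 0 →
      (∀ x, x ≠ 0 → Integrable (fun s => Real.exp (-∑ i, s i * (x i) ^ 2)) ν ∧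
          K x = ∫ s, Real.exp (-∑ i, s i * (x i) ^ 2) ∂ν) →
      Integrable (fun s : Fin 3 → ℝ => (s 0 * s 1 * s 2) ^ (-(1/2:ℝ)) *
        Real.exp (-(((1:ℝ)) / (4 * s 0) + ((0:ℝ)) / (4 * s 1)))) ν →
      Integrable (fun s : Fin 3 → ℝ => (s 0 * s 1 * s 2) ^ (-(1/2:ℝ)) *
        Real.exp (-(((1/2:ℝ)) / (4 * s 0) + ((1/2:ℝ)) / (4 * s 1)))) ν →
      ∫ s, (s 0 * s 1 * s 2) ^ (-(1/2:ℝ)) * Real.exp (-(((1:ℝ)) / (4 * s 0) + ((0:ℝ)) / (4 * s 1))) ∂ν =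
        ∫ s, (s 0 * s 1 * s 2) ^ (-(1/2:ℝ)) * Real.exp (-(((1/2:ℝ)) / (4 * s 0) + ((1/2:ℝ)) / (4 * s 1))) ∂ν →
      ∀ (R : EuclideanSpace ℝ (Fin 3) ≃ₗᵢ[ℝ] EuclideanSpace ℝ (Fin 3)) (x : EuclideanSpace ℝ (Fin 3)),
        K (R x) = K x) := by
  intro h
  set s₀ : Fin 3 → ℝ := ![1, 1, 2] with hs₀
  set K : EuclideanSpace ℝ (Fin 3) → ℝ := fun x => Real.exp (-∑ i, s₀ i * (x i) ^ 2) with hK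
  set ν : Measure (Fin 3 → ℝ) := Measure.dirac s₀ with hν
  have hint : ∀ f : (Fin 3 → ℝ) → ℝ, Integrable f ν := fun f =>
    (integrable_const (f s₀)).congr (ae_eq_dirac f).symm
  have hoct : ν {s | ∃ i, s i ≤ 0} = 0 := by
    rw [hν, Measure.dirac_apply, Set.indicator_of_notMem]
    simp only [mem_setOf_eq, not_exists, not_le]
    intro i; fin_cases i <;> simp [hs₀]
  have hrep : ∀ x : EuclideanSpace ℝ (Fin 3), x ≠ 0 →
      Integrable (fun s => Real.exp (-∑ i, s i * (x i) ^ 2)) ν ∧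
        K x = ∫ s, Real.exp (-∑ i, s i * (x i) ^ 2) ∂ν := fun x _ =>
    ⟨hint _, by rw [hν, integral_dirac]⟩
  have hamp : ∫ s, (s 0 * s 1 * s 2) ^ (-(1/2:ℝ)) * Real.exp (-(((1:ℝ)) / (4 * s 0) + ((0:ℝ)) / (4 * s 1))) ∂ν =
      ∫ s, (s 0 * s 1 * s 2) ^ (-(1/2:ℝ)) * Real.exp (-(((1/2:ℝ)) / (4 * s 0) + ((1/2:ℝ)) / (4 * s 1))) ∂ν := by
    rw [hν, integral_dirac, integral_dirac]
    simp [hs₀]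
    norm_num
  have key := h K ν hoct hrep (hint _) (hint _) hamp
    (LinearIsometryEquiv.piLpCongrLeft 2 ℝ ℝ (Equiv.swap (0 : Fin 3) 2)) (EuclideanSpace.single 0 1)
  have h1 : K (LinearIsometryEquiv.piLpCongrLeft 2 ℝ ℝ (Equiv.swap (0 : Fin 3) 2)
      (EuclideanSpace.single 0 1)) = Real.exp (-2) := by
    simp [hK, hs₀, Fin.sum_univ_three, Equiv.swap_apply_left]
  have h2 : K (EuclideanSpace.single 0 1) = Real.exp (-1) := by
    simp [hK, hs₀, Fin.sum_univ_three]
  rw [h1, h2] at key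
  have := Real.exp_injective key
  norm_num at this

/-- `p > 0` is load-bearing in the k-side lever `SliceRigidity` (the Prop above, = stub `stub_sliceRigidity`
of the line `swap-pencil-branch-arc` up to inlining): at `p = 0` every pencil is the constant `G(0,π)`,
entire, and `G = δ_{π/4}` charges `(0,π/2)`. -/
theorem not_sliceRigidity_zero : ¬ SliceRigidity 0 := by
  intro h
  have hmem : Real.pi / 4 ∈ Ioo 0 Real.pi := ⟨by positivity, by linarith [Real.pi_pos]⟩
  have hmem' : Real.pi / 4 ∈ Ioo 0 (Real.pi / 2) := ⟨by positivity, by linarith [Real.pi_pos]⟩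
  have key := h (Measure.dirac (Real.pi / 4)) inferInstance
    (by rw [Measure.dirac_apply, Set.indicator_of_notMem (Set.notMem_compl_iff.2 hmem)])
    ⟨fun _ => ((Measure.dirac (Real.pi / 4)) (Ioo 0 Real.pi)).toReal, differentiableOn_const _, by
      intro t _ _
      simp only [neg_zero, Real.rpow_zero, integral_const, smul_eq_mul, mul_one,
        Measure.restrict_apply MeasurableSet.univ, Set.univ_inter, Measure.real]⟩
  rw [Measure.dirac_apply_of_mem hmem'] at key
  exact one_ne_zero key

/-- The Joukowski pull-back of the order-`Δ` Stieltjes transform — verbatim restatement of `joukStieltjes`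
of `Lines/tilted-lightcone-jump-positivity.lean` (namespace `…Cruxes.GSMRigidity.TiltedLightconeJumpPositivity`). -/
def joukStieltjesX (Δ : ℝ) (ρ : Measure ℝ) (T : ℝ) : ℝ := ∫ c, (T + T⁻¹ - c) ^ (-Δ) ∂ρ

/-- The x-side lever `SliceNoMass Δ` of the line `tilted-lightcone-jump-positivity`, restated verbatim
(`rightHalfPlane` inlined). Audited TRUE for `0 < Δ ≤ 1` (F11); empty at `Δ = 0` (`not_sliceNoMassX_zero`). -/
def SliceNoMassX (Δ : ℝ) : Prop :=
  ∀ ρ : Measure ℝ, IsFiniteMeasure ρ → ρ (Icc (-2) 2)ᶜ = 0 →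
    (∃ F : ℂ → ℂ, DifferentiableOn ℂ F {z : ℂ | 0 < z.re} ∧
      ∀ T : ℝ, 0 < T → T ≠ 1 → F (T : ℂ) = ((joukStieltjesX Δ ρ T : ℝ) : ℂ)) →
    ρ (Ioo 0 2) = 0

/-- `Δ > 0` is load-bearing in the x-side lever: at `Δ = 0` the transform is the constant `ρ(ℝ)` and
`ρ = δ₁` charges `(0,2)`. -/
theorem not_sliceNoMassX_zero : ¬ SliceNoMassX 0 := by
  intro h
  have hmem : (1 : ℝ) ∈ Icc (-2 : ℝ) 2 := ⟨by norm_num, by norm_num⟩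
  have hmem' : (1 : ℝ) ∈ Ioo (0 : ℝ) 2 := ⟨by norm_num, by norm_num⟩
  have key := h (Measure.dirac 1) inferInstance
    (by rw [Measure.dirac_apply, Set.indicator_of_notMem (Set.notMem_compl_iff.2 hmem)])
    ⟨fun _ => (1 : ℂ), differentiableOn_const _, by
      intro T _ _
      simp [joukStieltjesX]⟩
  rw [Measure.dirac_apply_of_mem hmem'] at key
  exact one_ne_zero key

/-! ### (b‴) The x-side lever has a sign: no cancellation across the anisotropy measure -/

/-- **For `Im w > 0`, real `c` and `0 < Δ ≤ 1`: `Im (w - c)^{-Δ} < 0`** (principal branch). Every term of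
`Im ∫ (w - c)^{-Δ} dρ(c)` is negative on the upper half-plane — the one-signedness behind the boundary
jump of the order-`Δ` Stieltjes transform in `stub_sliceNoMass_lt_one` (line
`tilted-lightcone-jump-positivity`), the x-side twin of `arcBase_eq` + `jumpIntegrand_pos`. -/
theorem im_cpow_neg_neg {w : ℂ} (hw : 0 < w.im) (c : ℝ) {Δ : ℝ} (h0 : 0 < Δ) (h1 : Δ ≤ 1) :
    ((w - c) ^ (-(Δ : ℂ))).im < 0 := by
  set z : ℂ := w - c with hz
  have hzim : z.im = w.im := by simp [hz]
  have hz0 : z ≠ 0 := by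
    intro h; rw [h] at hzim; simp at hzim; linarith
  have harg_pos : 0 < Complex.arg z := by
    rcases lt_trichotomy (Complex.arg z) 0 with hlt | heq | hgt
    · exact absurd (Complex.arg_neg_iff.1 hlt) (by rw [hzim]; exact not_lt.2 hw.le)
    · exfalso
      have := Complex.arg_eq_zero_iff.1 heq
      rw [hzim] at this
      linarith [this.2]
    · exact hgt
  have harg_lt : Complex.arg z < Real.pi := by
    rw [Complex.arg_lt_pi_iff]
    exact Or.inr (by rw [hzim]; exact hw.ne')
  rw [Complex.cpow_def_of_ne_zero hz0, Complex.exp_im]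
  have hre : (Complex.log z * -(Δ : ℂ)).im = -(Δ * Complex.arg z) := by
    simp [Complex.log_im, mul_comm]
  rw [hre, Real.sin_neg]
  have hsin : 0 < Real.sin (Δ * Complex.arg z) := by
    apply Real.sin_pos_of_pos_of_lt_pi (mul_pos h0 harg_pos)
    calc Δ * Complex.arg z ≤ 1 * Complex.arg z := by gcongr
      _ < Real.pi := by rw [one_mul]; exact harg_lt
  have hexp : 0 < Real.exp (Complex.log z * -(Δ : ℂ)).re := Real.exp_pos _
  nlinarith

/-- Companion on the lower half-plane: `Im w < 0 ⇒ 0 < Im (w - c)^{-Δ}` (`0 < Δ ≤ 1`). -/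
theorem im_cpow_neg_pos {w : ℂ} (hw : w.im < 0) (c : ℝ) {Δ : ℝ} (h0 : 0 < Δ) (h1 : Δ ≤ 1) :
    0 < ((w - c) ^ (-(Δ : ℂ))).im := by
  set z : ℂ := w - c with hz
  have hzim : z.im = w.im := by simp [hz]
  have hz0 : z ≠ 0 := by
    intro h; rw [h] at hzim; simp at hzim; linarith
  have harg_neg : Complex.arg z < 0 := Complex.arg_neg_iff.2 (by rw [hzim]; exact hw)
  have harg_gt : -Real.pi < Complex.arg z := Complex.neg_pi_lt_arg z
  rw [Complex.cpow_def_of_ne_zero hz0, Complex.exp_im]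
  have hre : (Complex.log z * -(Δ : ℂ)).im = -(Δ * Complex.arg z) := by
    simp [Complex.log_im, mul_comm]
  rw [hre]
  have hsin : 0 < Real.sin (-(Δ * Complex.arg z)) := by
    apply Real.sin_pos_of_pos_of_lt_pi
    · nlinarith
    · calc -(Δ * Complex.arg z) = Δ * (-Complex.arg z) := by ring
        _ ≤ 1 * (-Complex.arg z) := by gcongr; linarith
        _ < Real.pi := by linarith
  exact mul_pos (Real.exp_pos _) hsin

/-! ### (b⁗) Gluing and Joukowski bookkeeping for the x-side lever (tools, F14) -/

/-- **Identity theorem from a real interval.** Two functions holomorphic on an open preconnected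
`U ⊆ ℂ` containing the real interval `(a,b)` that agree there agree on `U` (the gluing step of every line:
`F = S∘J` on `D±` from `(1,∞)` / `(0,1)`; `F = Φ̃` on the disc from `(0,1)`). [folklore] -/
theorem eqOn_of_isPreconnected_of_eqOn_Ioo {U : Set ℂ} (hU : IsOpen U) (hUc : IsPreconnected U)
    {a b : ℝ} (hab : a < b) (hsub : ∀ t : ℝ, a < t → t < b → (t : ℂ) ∈ U) {F G : ℂ → ℂ}
    (hF : DifferentiableOn ℂ F U) (hG : DifferentiableOn ℂ G U)
    (h : ∀ t : ℝ, a < t → t < b → F t = G t) : EqOn F G U := by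
  have hFa : AnalyticOnNhd ℂ F U := hF.analyticOnNhd hU
  have hGa : AnalyticOnNhd ℂ G U := hG.analyticOnNhd hU
  -- accumulate at the midpoint `c = (a+b)/2` along `c + (b-a)/(2(n+2))`
  set c : ℝ := (a + b) / 2 with hc
  have hcmem : (c : ℂ) ∈ U := hsub c (by rw [hc]; linarith) (by rw [hc]; linarith)
  refine hFa.eqOn_of_preconnected_of_frequently_eq hGa hUc hcmem ?_
  set u : ℕ → ℝ := fun n => c + (b - a) / 2 * (1 / ((n : ℝ) + 2)) with hu
  have hu_gt : ∀ n, c < u n := fun n => by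
    have : (0 : ℝ) < (b - a) / 2 * (1 / ((n : ℝ) + 2)) := by
      have hba : 0 < b - a := by linarith
      positivity
    simp only [hu]; linarith
  have hu_lt : ∀ n, u n < b := fun n => by
    have h2 : (1 / ((n : ℝ) + 2)) ≤ 1 / 2 := by
      rw [div_le_div_iff_of_pos_left one_pos (by positivity) (by norm_num)]
      linarith [(Nat.cast_nonneg n : (0 : ℝ) ≤ n)]
    have hba : 0 < b - a := by linarith
    have : (b - a) / 2 * (1 / ((n : ℝ) + 2)) ≤ (b - a) / 2 * (1 / 2) :=
      mul_le_mul_of_nonneg_left h2 (by positivity)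
    simp only [hu, hc]; nlinarith
  have hu_gt_a : ∀ n, a < u n := fun n => by
    have := hu_gt n; rw [hc] at this; linarith
  have htend : Tendsto (fun n : ℕ => ((u n : ℝ) : ℂ)) atTop (𝓝[≠] (c : ℂ)) := by
    rw [tendsto_nhdsWithin_iff]
    constructor
    · have h0 : Tendsto u atTop (𝓝 c) := by
        have h1 : Tendsto (fun n : ℕ => 1 / ((n : ℝ) + 2)) atTop (𝓝 0) := by
          have := tendsto_one_div_add_atTop_nhds_zero_nat (𝕜 := ℝ)
          have h' : Tendsto (fun n : ℕ => n + 1) atTop atTop := tendsto_add_atTop_nat 1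
          have := this.comp h'
          refine this.congr fun n => ?_
          simp only [Function.comp_apply, Nat.cast_add, Nat.cast_one]
          ring_nf
        have h2 := (h1.const_mul ((b - a) / 2)).const_add c
        simpa [hu] using h2
      have h1' := (Complex.continuous_ofReal.tendsto c).comp h0
      simpa [Function.comp_def] using h1'
    · refine Eventually.of_forall fun n => ?_
      simp only [mem_compl_iff, mem_singleton_iff]
      intro heq
      have hre := congrArg Complex.re heq
      simp only [Complex.ofReal_re] at hre
      linarith [hu_gt n]
  refine htend.frequently (Frequently.of_forall fun n => ?_)
  exact h _ (hu_gt_a n) (hu_lt n)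

/-- Joukowski bookkeeping (x-side S3): `Im (T + T⁻¹) = Im T · (1 - 1/‖T‖²)`. [folklore] -/
theorem im_add_inv (T : ℂ) : (T + T⁻¹).im = T.im * (1 - 1 / ‖T‖ ^ 2) := by
  rw [Complex.add_im, Complex.inv_im, ← Complex.normSq_eq_norm_sq]
  ring

/-- Joukowski bookkeeping: `Re (T + T⁻¹) = Re T · (1 + 1/‖T‖²)`. [folklore] -/
theorem re_add_inv (T : ℂ) : (T + T⁻¹).re = T.re * (1 + 1 / ‖T‖ ^ 2) := by
  rw [Complex.add_re, Complex.inv_re, ← Complex.normSq_eq_norm_sq]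
  ring

/-- Outside the unit circle in the upper half-plane the Joukowski image is in the upper half-plane
(and inside, in the lower): the sign of `Im J` is `sign(Im T)·sign(|T|-1)`. [folklore] -/
theorem im_add_inv_pos {T : ℂ} (hT : 1 < ‖T‖) (him : 0 < T.im) : 0 < (T + T⁻¹).im := by
  rw [im_add_inv]
  have h1 : 1 < ‖T‖ ^ 2 := by nlinarith [norm_nonneg T]
  have h2 : 0 < 1 - 1 / ‖T‖ ^ 2 := by
    rw [sub_pos, div_lt_one (by positivity)]; exact h1
  exact mul_pos him h2

/-- Inside the unit circle in the upper half-plane the Joukowski image is in the LOWER half-plane. [folklore] -/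
theorem im_add_inv_neg {T : ℂ} (hT0 : T ≠ 0) (hT : ‖T‖ < 1) (him : 0 < T.im) : (T + T⁻¹).im < 0 := by
  rw [im_add_inv]
  have hpos : 0 < ‖T‖ := norm_pos_iff.2 hT0
  have h1 : ‖T‖ ^ 2 < 1 := by nlinarith [norm_nonneg T]
  have h2 : 1 - 1 / ‖T‖ ^ 2 < 0 := by
    rw [sub_neg, one_lt_div (by positivity)]; exact h1
  exact mul_neg_of_pos_of_neg him h2

/-- On the open right half-plane the Joukowski image has positive real part. [folklore] -/
theorem re_add_inv_pos {T : ℂ} (hre : 0 < T.re) : 0 < (T + T⁻¹).re := by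
  rw [re_add_inv]
  exact mul_pos hre (by positivity)

/-- `T + T⁻¹` is real only on the real axis or on the unit circle; in particular the open regions
`D± = {|T| ≷ 1, Re T > 0}` are mapped off the real axis except along the positive real axis itself, so
their images avoid the slit `(0,2]` (there `T + 1/T > 2` for real `T ≠ 1`). [folklore] -/
theorem add_inv_im_eq_zero_iff {T : ℂ} (hT0 : T ≠ 0) : (T + T⁻¹).im = 0 ↔ T.im = 0 ∨ ‖T‖ = 1 := by
  rw [im_add_inv, mul_eq_zero]
  have hpos : 0 < ‖T‖ := norm_pos_iff.2 hT0
  constructor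
  · rintro (h | h)
    · exact Or.inl h
    · right
      have h' : ‖T‖ ^ 2 = 1 := by
        field_simp at h
        nlinarith [h]
      nlinarith [norm_nonneg T]
  · rintro (h | h)
    · exact Or.inl h
    · right; rw [h]; norm_num

/-- For real `T > 0`, `T ≠ 1`: `T + 1/T > 2` (the real axis of `D±` lands to the right of the slit). -/
theorem two_lt_add_inv {T : ℝ} (hT : 0 < T) (hT1 : T ≠ 1) : 2 < T + T⁻¹ := by
  have h : 0 < (T - 1) ^ 2 := by positivity
  have hT' : T⁻¹ = 1 / T := (one_div T).symm
  rw [hT', ← sub_pos]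
  have : T + 1 / T - 2 = (T - 1) ^ 2 / T := by field_simp; ring
  rw [this]; positivity

/-! ### (b⁗′) Boundary values of the lever atoms from the upper half-plane (tools, F14) -/

open Complex in
/-- **Boundary value of the lever's atoms from the upper half-plane.** For real `w₀ < c` the principal
power `(w - c)^{-Δ}` tends, as `w → w₀` within the CLOSED upper half-plane, to
`(c - w₀)^{-Δ} e^{-iπΔ}`; in particular its imaginary part tends to `-(c - w₀)^{-Δ} sin(πΔ)`, which is
`< 0` for `0 < Δ < 1` — the positive mass that Fatou extracts from `ρ((w₀,2])` in `stub_sliceNoMass_lt_one`. -/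
theorem tendsto_cpow_neg_nhdsWithin_im_nonneg {w₀ c : ℝ} (h : w₀ < c) (Δ : ℝ) :
    Tendsto (fun w : ℂ => (w - c) ^ (-(Δ : ℂ))) (𝓝[{w : ℂ | 0 ≤ w.im}] (w₀ : ℂ))
      (𝓝 (((c - w₀) ^ (-Δ) : ℝ) * exp (-(Real.pi * Δ) * I))) := by
  -- `w ↦ w - c` maps the closed upper half-plane to itself and `w₀ ↦ w₀ - c < 0`
  have hz : ((w₀ : ℂ) - c).re < 0 := by simp; linarith
  have hzim : ((w₀ : ℂ) - c).im = 0 := by simp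
  have hmaps : MapsTo (fun w : ℂ => w - c) {w : ℂ | 0 ≤ w.im} {w : ℂ | 0 ≤ w.im} := by
    intro w hw; simpa using hw
  have hsub : Tendsto (fun w : ℂ => w - c) (𝓝[{w : ℂ | 0 ≤ w.im}] (w₀ : ℂ))
      (𝓝[{w : ℂ | 0 ≤ w.im}] ((w₀ : ℂ) - c)) :=
    tendsto_nhdsWithin_of_tendsto_nhds_of_eventually_within _
      ((continuous_sub_right (c : ℂ)).tendsto (w₀ : ℂ) |>.mono_left nhdsWithin_le_nhds)
      (eventually_nhdsWithin_of_forall fun w hw => hmaps hw)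
  have hlog := (tendsto_log_nhdsWithin_im_nonneg_of_re_neg_of_im_zero hz hzim).comp hsub
  -- exponentiate
  have hexp : Tendsto (fun w : ℂ => exp (log (w - c) * (-(Δ : ℂ))))
      (𝓝[{w : ℂ | 0 ≤ w.im}] (w₀ : ℂ))
      (𝓝 (exp ((Real.log ‖(w₀ : ℂ) - c‖ + Real.pi * I) * (-(Δ : ℂ))))) :=
    (continuous_exp.tendsto _).comp (hlog.mul_const _)
  -- identify the limit value
  have hnorm : ‖(w₀ : ℂ) - c‖ = c - w₀ := by
    rw [← Complex.ofReal_sub, Complex.norm_real, Real.norm_eq_abs, abs_of_neg (by linarith)]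
    ring
  have hval : exp ((Real.log ‖(w₀ : ℂ) - c‖ + Real.pi * I) * (-(Δ : ℂ))) =
      ((c - w₀) ^ (-Δ) : ℝ) * exp (-(Real.pi * Δ) * I) := by
    rw [hnorm, add_mul, Complex.exp_add, Real.rpow_def_of_pos (by linarith), Complex.ofReal_exp]
    push_cast
    ring_nf
  rw [hval] at hexp
  -- `(w - c)^{-Δ} = exp(log(w-c)·(-Δ))` eventually (indeed whenever `w ≠ c`, in particular near `w₀ ≠ c`)
  refine hexp.congr' ?_
  have hne : ∀ᶠ w : ℂ in 𝓝[{w : ℂ | 0 ≤ w.im}] (w₀ : ℂ), w - (c : ℂ) ≠ 0 := by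
    have hopen : IsOpen {w : ℂ | w - c ≠ 0} := isOpen_ne_fun (continuous_sub_right _) continuous_const
    have hmem : (w₀ : ℂ) ∈ {w : ℂ | w - c ≠ 0} := by
      simp only [mem_setOf_eq, sub_ne_zero]
      intro heq; have := congrArg Complex.re heq; simp at this; linarith
    exact mem_nhdsWithin_of_mem_nhds (hopen.mem_nhds hmem)
  filter_upwards [hne] with w hw
  rw [cpow_def_of_ne_zero hw]

open Complex in
/-- The imaginary part of that boundary value: `-(c - w₀)^{-Δ} sin(πΔ)` (`< 0` for `0 < Δ < 1`). -/
theorem tendsto_cpow_neg_im_nhdsWithin_im_nonneg {w₀ c : ℝ} (h : w₀ < c) (Δ : ℝ) :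
    Tendsto (fun w : ℂ => ((w - c) ^ (-(Δ : ℂ))).im) (𝓝[{w : ℂ | 0 ≤ w.im}] (w₀ : ℂ))
      (𝓝 (-(c - w₀) ^ (-Δ) * Real.sin (Real.pi * Δ))) := by
  have h1 := (continuous_im.tendsto _).comp (tendsto_cpow_neg_nhdsWithin_im_nonneg h Δ)
  have hval : ((((c - w₀) ^ (-Δ) : ℝ) : ℂ) * exp (-(Real.pi * Δ) * I)).im =
      -(c - w₀) ^ (-Δ) * Real.sin (Real.pi * Δ) := by
    simp [Complex.mul_im, Complex.exp_im, Complex.exp_re, Real.sin_neg]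
  rw [hval] at h1
  exact h1

/-- Hence, for `0 < Δ < 1`, the boundary value has NEGATIVE imaginary part `-(c-w₀)^{-Δ} sin(πΔ) < 0`:
the `c > w₀` part of the anisotropy measure contributes a strictly positive amount to `-Im S(w₀ + i0)`. -/
theorem lever_boundary_im_neg {w₀ c : ℝ} (h : w₀ < c) {Δ : ℝ} (h0 : 0 < Δ) (h1 : Δ < 1) :
    -(c - w₀) ^ (-Δ) * Real.sin (Real.pi * Δ) < 0 := by
  have hpow : 0 < (c - w₀) ^ (-Δ) := Real.rpow_pos_of_pos (by linarith) _
  have hsin : 0 < Real.sin (Real.pi * Δ) :=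
    Real.sin_pos_of_pos_of_lt_pi (by positivity) (by nlinarith [Real.pi_pos])
  nlinarith

/-! ### (b⁗″) The order-`Δ` Stieltjes transform is holomorphic off the cut (tools, F14) -/

open Complex in
/-- Separation from the slit: near a point `w₀` off `(-∞,2]`, every `w - c` with `c ∈ [-2,2]` has norm
at least `m/2`, `m = max |Im w₀| (Re w₀ - 2) > 0`, and lies in the slit plane. [folklore] -/
theorem slit_separation {w₀ : ℂ} (hw₀ : w₀.im ≠ 0 ∨ 2 < w₀.re) :
    0 < max |w₀.im| (w₀.re - 2) ∧
      ∀ w ∈ Metric.ball w₀ (max |w₀.im| (w₀.re - 2) / 2), ∀ c : ℝ, c ∈ Icc (-2 : ℝ) 2 →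
        max |w₀.im| (w₀.re - 2) / 2 ≤ ‖w - (c : ℂ)‖ ∧ (w - (c : ℂ)) ∈ slitPlane := by
  set m : ℝ := max |w₀.im| (w₀.re - 2) with hm
  have hm_pos : 0 < m := by
    rcases hw₀ with h | h
    · exact lt_max_of_lt_left (abs_pos.2 h)
    · exact lt_max_of_lt_right (by linarith)
  refine ⟨hm_pos, fun w hw c hc => ?_⟩
  have hdist : ‖w - w₀‖ < m / 2 := by simpa [dist_eq_norm] using hw
  have hre_le : |(w - w₀).re| ≤ ‖w - w₀‖ := abs_re_le_norm _
  have him_le : |(w - w₀).im| ≤ ‖w - w₀‖ := abs_im_le_norm _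
  rw [Complex.sub_re] at hre_le
  rw [Complex.sub_im] at him_le
  rcases max_choice |w₀.im| (w₀.re - 2) with h | h
  · -- `m = |Im w₀|`: the imaginary part stays away from `0`
    have hm' : m = |w₀.im| := by rw [hm, h]
    have him : m / 2 < |w.im| := by
      have h1 : |w₀.im| ≤ |w.im| + |w.im - w₀.im| := by
        have := abs_sub_abs_le_abs_sub w₀.im w.im
        rw [abs_sub_comm] at this; linarith
      linarith
    have himc : (w - (c : ℂ)).im = w.im := by simp
    constructor
    · calc m / 2 ≤ |w.im| := him.le
        _ = |(w - (c : ℂ)).im| := by rw [himc]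
        _ ≤ ‖w - (c : ℂ)‖ := abs_im_le_norm _
    · rw [mem_slitPlane_iff]; right
      rw [himc]; intro h0; rw [h0, abs_zero] at him; linarith
  · -- `m = Re w₀ - 2`: the real part stays to the right of `2 ≥ c`
    have hm' : m = w₀.re - 2 := by rw [hm, h]
    have hre : m / 2 < (w - (c : ℂ)).re := by
      have hrec : (w - (c : ℂ)).re = w.re - c := by simp
      rw [hrec]
      have : w₀.re - m / 2 < w.re := by
        have := (abs_lt.1 (lt_of_le_of_lt hre_le hdist)).1; linarith
      linarith [hc.2]
    constructor
    · calc m / 2 ≤ |(w - (c : ℂ)).re| := by rw [abs_of_pos (by linarith)]; exact hre.le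
        _ ≤ ‖w - (c : ℂ)‖ := abs_re_le_norm _
    · rw [mem_slitPlane_iff]; left; linarith

open Complex in
/-- **The order-`Δ` Stieltjes transform `S(w) = ∫ (w - c)^{-Δ} dρ(c)` of a finite measure on `[-2,2]` is
holomorphic off the cut `(-∞,2]`** (`0 ≤ Δ`; principal branch) — the function `S` with `F = S∘J` on
`D±` in `stub_sliceNoMass_*` (line `tilted-lightcone-jump-positivity`). Parametric differentiation with
the locally uniform bound `|Δ| (m/2)^{-Δ-1}` on the derivative. -/
theorem differentiableOn_orderStieltjes {Δ : ℝ} (hΔ : 0 ≤ Δ) (ρ : Measure ℝ) [IsFiniteMeasure ρ]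
    (hρ : ρ (Icc (-2) 2)ᶜ = 0) :
    DifferentiableOn ℂ (fun w : ℂ => ∫ c, (w - (c : ℂ)) ^ (-(Δ : ℂ)) ∂ρ)
      {w : ℂ | w.im ≠ 0 ∨ 2 < w.re} := by
  intro w₀ hw₀
  obtain ⟨hm_pos, hsep⟩ := slit_separation hw₀
  set m : ℝ := max |w₀.im| (w₀.re - 2) with hm
  have hae : ∀ᵐ c ∂ρ, c ∈ Icc (-2 : ℝ) 2 := by
    filter_upwards [measure_eq_zero_iff_ae_notMem.1 hρ] with c hc
    simpa using hc
  -- the data of `hasDerivAt_integral_of_dominated_loc_of_deriv_le`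
  set F : ℂ → ℝ → ℂ := fun w c => (w - (c : ℂ)) ^ (-(Δ : ℂ)) with hF
  set F' : ℂ → ℝ → ℂ := fun w c => -(Δ : ℂ) * (w - (c : ℂ)) ^ (-(Δ : ℂ) - 1) * 1 with hF'
  have hmeasF : ∀ w, AEStronglyMeasurable (F w) ρ := fun w =>
    ((measurable_const.sub measurable_ofReal).pow_const _).aestronglyMeasurable
  have hmeasF' : ∀ w, AEStronglyMeasurable (F' w) ρ := fun w =>
    ((measurable_const.mul ((measurable_const.sub measurable_ofReal).pow_const _)).mul
      measurable_const).aestronglyMeasurable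
  have hball : Metric.ball w₀ (m / 2) ∈ 𝓝 w₀ := Metric.ball_mem_nhds _ (by positivity)
  -- norms of the atoms and their derivatives on the ball
  have hnormF : ∀ w ∈ Metric.ball w₀ (m / 2), ∀ c ∈ Icc (-2 : ℝ) 2,
      ‖F w c‖ ≤ (m / 2) ^ (-Δ) := by
    intro w hw c hc
    obtain ⟨hle, -⟩ := hsep w hw c hc
    simp only [hF]
    rw [show (-(Δ : ℂ)) = ((-Δ : ℝ) : ℂ) by push_cast; ring, norm_cpow_real]
    exact Real.rpow_le_rpow_of_nonpos (by positivity) hle (by linarith)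
  have hnormF' : ∀ w ∈ Metric.ball w₀ (m / 2), ∀ c ∈ Icc (-2 : ℝ) 2,
      ‖F' w c‖ ≤ |Δ| * (m / 2) ^ (-Δ - 1) := by
    intro w hw c hc
    obtain ⟨hle, -⟩ := hsep w hw c hc
    simp only [hF', mul_one, norm_mul, norm_neg, Complex.norm_real, Real.norm_eq_abs]
    rw [show (-(Δ : ℂ) - 1) = ((-Δ - 1 : ℝ) : ℂ) by push_cast; ring, norm_cpow_real]
    exact mul_le_mul_of_nonneg_left
      (Real.rpow_le_rpow_of_nonpos (by positivity) hle (by linarith)) (abs_nonneg _)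
  have hint : Integrable (F w₀) ρ := by
    refine Integrable.mono' (integrable_const ((m / 2) ^ (-Δ))) (hmeasF w₀) ?_
    filter_upwards [hae] with c hc
    exact hnormF w₀ (Metric.mem_ball_self (by positivity)) c hc
  have hbound : ∀ᵐ c ∂ρ, ∀ w ∈ Metric.ball w₀ (m / 2), ‖F' w c‖ ≤ |Δ| * (m / 2) ^ (-Δ - 1) := by
    filter_upwards [hae] with c hc w hw
    exact hnormF' w hw c hc
  have hdiff : ∀ᵐ c ∂ρ, ∀ w ∈ Metric.ball w₀ (m / 2), HasDerivAt (F · c) (F' w c) w := by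
    filter_upwards [hae] with c hc w hw
    obtain ⟨-, hslit⟩ := hsep w hw c hc
    simp only [hF, hF']
    exact ((hasDerivAt_id' w).sub_const (c : ℂ)).cpow_const hslit
  have key := hasDerivAt_integral_of_dominated_loc_of_deriv_le hball
    (Eventually.of_forall hmeasF) hint (hmeasF' w₀) hbound (integrable_const _) hdiff
  exact key.2.differentiableAt.differentiableWithinAt

/-! ### (b⁗‴) `J` maps `D±` into the slit domain; `D±` are open and preconnected (tools, F14) -/

open Complex in
/-- The outer region `D₊ = {|T| > 1, Re T > 0}` is mapped by the Joukowski map `J(T) = T + 1/T` into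
`ℂ ∖ (-∞,2] = {Im w ≠ 0} ∪ {Re w > 2}` (the domain of holomorphy of the order-`Δ` Stieltjes transform):
off the real axis `Im J = Im T (1 - 1/|T|²) ≠ 0`, on it `T > 1` and `T + 1/T > 2`. [folklore] -/
theorem mapsTo_joukowski_outer :
    MapsTo (fun T : ℂ => T + T⁻¹) {T : ℂ | 1 < ‖T‖ ∧ 0 < T.re} {w : ℂ | w.im ≠ 0 ∨ 2 < w.re} := by
  rintro T ⟨hT, hre⟩
  by_cases him : T.im = 0
  · -- real `T > 1`
    right
    have hT0 : T = (T.re : ℂ) := by apply Complex.ext <;> simp [him]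
    have hre1 : 1 < T.re := by
      have : ‖T‖ = |T.re| := by rw [hT0]; simp
      rw [this, abs_of_pos hre] at hT; exact hT
    show 2 < (T + T⁻¹).re
    rw [hT0, ← Complex.ofReal_inv, ← Complex.ofReal_add, Complex.ofReal_re]
    exact two_lt_add_inv (by linarith) (by linarith)
  · left
    rw [im_add_inv]
    have h1 : 1 < ‖T‖ ^ 2 := by nlinarith [norm_nonneg T]
    have h2 : 0 < 1 - 1 / ‖T‖ ^ 2 := by
      rw [sub_pos, div_lt_one (by positivity)]; exact h1
    exact mul_ne_zero him h2.ne'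

open Complex in
/-- The inner region `D₋ = {0 < |T| < 1, Re T > 0}` is mapped by `J` into `ℂ ∖ (-∞,2]` as well
(`Im J = Im T (1 - 1/|T|²) ≠ 0` off the axis; `0 < T < 1 ⇒ T + 1/T > 2` on it). [folklore] -/
theorem mapsTo_joukowski_inner :
    MapsTo (fun T : ℂ => T + T⁻¹) {T : ℂ | ‖T‖ < 1 ∧ 0 < T.re} {w : ℂ | w.im ≠ 0 ∨ 2 < w.re} := by
  rintro T ⟨hT, hre⟩
  have hT0' : T ≠ 0 := fun h => by rw [h] at hre; simp at hre
  by_cases him : T.im = 0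
  · right
    have hT0 : T = (T.re : ℂ) := by apply Complex.ext <;> simp [him]
    have hre1 : T.re < 1 := by
      have : ‖T‖ = |T.re| := by rw [hT0]; simp
      rw [this, abs_of_pos hre] at hT; exact hT
    show 2 < (T + T⁻¹).re
    rw [hT0, ← Complex.ofReal_inv, ← Complex.ofReal_add, Complex.ofReal_re]
    exact two_lt_add_inv hre (by linarith)
  · left
    rw [im_add_inv]
    have hpos : 0 < ‖T‖ := norm_pos_iff.2 hT0'
    have h1 : ‖T‖ ^ 2 < 1 := by nlinarith [norm_nonneg T]
    have h2 : 1 - 1 / ‖T‖ ^ 2 < 0 := by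
      rw [sub_neg, one_lt_div (by positivity)]; exact h1
    exact mul_ne_zero him h2.ne

open Complex in
/-- Polar description of the outer region: `D₊ = {r e^{iθ} : r > 1, |θ| < π/2}`. [folklore] -/
theorem outer_eq_image_polar :
    {T : ℂ | 1 < ‖T‖ ∧ 0 < T.re} =
      (fun p : ℝ × ℝ => (p.1 : ℂ) * exp (p.2 * I)) '' (Ioi (1 : ℝ) ×ˢ Ioo (-(Real.pi / 2)) (Real.pi / 2)) := by
  ext T
  simp only [mem_setOf_eq, mem_image, mem_prod, mem_Ioi, mem_Ioo, Prod.exists]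
  constructor
  · rintro ⟨hT, hre⟩
    refine ⟨‖T‖, arg T, ⟨hT, ?_⟩, norm_mul_exp_arg_mul_I T⟩
    exact abs_lt.1 (abs_arg_lt_pi_div_two_iff.2 (Or.inl hre))
  · rintro ⟨r, θ, ⟨hr, hθ1, hθ2⟩, rfl⟩
    have hr0 : 0 < r := by linarith
    constructor
    · rw [norm_mul, norm_exp_ofReal_mul_I, mul_one, Complex.norm_real, Real.norm_eq_abs,
        abs_of_pos hr0]
      exact hr
    · rw [Complex.re_ofReal_mul, exp_ofReal_mul_I_re]
      exact mul_pos hr0 (Real.cos_pos_of_mem_Ioo ⟨hθ1, hθ2⟩)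

open Complex in
/-- Polar description of the inner region: `D₋ = {r e^{iθ} : 0 < r < 1, |θ| < π/2}`. [folklore] -/
theorem inner_eq_image_polar :
    {T : ℂ | ‖T‖ < 1 ∧ 0 < T.re} =
      (fun p : ℝ × ℝ => (p.1 : ℂ) * exp (p.2 * I)) '' (Ioo (0 : ℝ) 1 ×ˢ Ioo (-(Real.pi / 2)) (Real.pi / 2)) := by
  ext T
  simp only [mem_setOf_eq, mem_image, mem_prod, mem_Ioo, Prod.exists]
  constructor
  · rintro ⟨hT, hre⟩
    have hT0 : T ≠ 0 := fun h => by rw [h] at hre; simp at hre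
    refine ⟨‖T‖, arg T, ⟨⟨norm_pos_iff.2 hT0, hT⟩, ?_⟩, norm_mul_exp_arg_mul_I T⟩
    exact abs_lt.1 (abs_arg_lt_pi_div_two_iff.2 (Or.inl hre))
  · rintro ⟨r, θ, ⟨⟨hr0, hr1⟩, hθ1, hθ2⟩, rfl⟩
    constructor
    · rw [norm_mul, norm_exp_ofReal_mul_I, mul_one, Complex.norm_real, Real.norm_eq_abs,
        abs_of_pos hr0]
      exact hr1
    · rw [Complex.re_ofReal_mul, exp_ofReal_mul_I_re]
      exact mul_pos hr0 (Real.cos_pos_of_mem_Ioo ⟨hθ1, hθ2⟩)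

open Complex in
/-- The polar map `(r,θ) ↦ r e^{iθ}` is continuous. [folklore] -/
theorem continuous_polar : Continuous (fun p : ℝ × ℝ => (p.1 : ℂ) * exp (p.2 * I)) := by
  fun_prop

open Complex in
/-- `D₊` is (pre)connected (continuous image of a product of intervals). [folklore] -/
theorem isPreconnected_outer : IsPreconnected {T : ℂ | 1 < ‖T‖ ∧ 0 < T.re} := by
  rw [outer_eq_image_polar]
  exact (isPreconnected_Ioi.prod isPreconnected_Ioo).image _ continuous_polar.continuousOn

open Complex in
/-- `D₋` is (pre)connected. [folklore] -/
theorem isPreconnected_inner : IsPreconnected {T : ℂ | ‖T‖ < 1 ∧ 0 < T.re} := by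
  rw [inner_eq_image_polar]
  exact (isPreconnected_Ioo.prod isPreconnected_Ioo).image _ continuous_polar.continuousOn

/-- `D₊` is open. [folklore] -/
theorem isOpen_outer : IsOpen {T : ℂ | 1 < ‖T‖ ∧ 0 < T.re} :=
  (isOpen_lt continuous_const continuous_norm).inter (isOpen_lt continuous_const Complex.continuous_re)

/-- `D₋` is open. [folklore] -/
theorem isOpen_inner : IsOpen {T : ℂ | ‖T‖ < 1 ∧ 0 < T.re} :=
  (isOpen_lt continuous_norm continuous_const).inter (isOpen_lt continuous_const Complex.continuous_re)

/-! ### (d) THE X-SIDE LEVER PROVED: `SliceNoMassX Δ` for `0 < Δ < 1` (= stub `stub_sliceNoMass_lt_one`) -/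

open Complex in
/-- Step A: on the real axis the complex transform `S ∘ J` is the real Joukowski–Stieltjes transform. -/
theorem S_J_real {Δ : ℝ} (ρ : Measure ℝ) [IsFiniteMeasure ρ] (hρ : ρ (Icc (-2) 2)ᶜ = 0)
    {t : ℝ} (ht : 0 < t) (ht1 : t ≠ 1) :
    (∫ c, (((t : ℂ) + (t : ℂ)⁻¹) - (c : ℂ)) ^ (-(Δ : ℂ)) ∂ρ) = ((joukStieltjesX Δ ρ t : ℝ) : ℂ) := by
  have hae : ∀ᵐ c ∂ρ, c ∈ Icc (-2 : ℝ) 2 := by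
    filter_upwards [measure_eq_zero_iff_ae_notMem.1 hρ] with c hc
    simpa using hc
  simp only [joukStieltjesX]
  rw [← integral_complex_ofReal]
  apply integral_congr_ae
  filter_upwards [hae] with c hc
  have hbase : 0 < t + t⁻¹ - c := by linarith [two_lt_add_inv ht ht1, hc.2]
  rw [Complex.ofReal_cpow hbase.le]
  push_cast
  ring_nf

open Complex in
/-- The per-point statement behind `SliceNoMassX`: for `w₀ ∈ (0,2)`, `ρ((w₀,2]) = 0`. -/
theorem noMass_Ioc {Δ : ℝ} (h0 : 0 < Δ) (h1 : Δ < 1) (ρ : Measure ℝ) [IsFiniteMeasure ρ]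
    (hρ : ρ (Icc (-2) 2)ᶜ = 0) (F : ℂ → ℂ) (hF : DifferentiableOn ℂ F {z : ℂ | 0 < z.re})
    (hFeq : ∀ T : ℝ, 0 < T → T ≠ 1 → F (T : ℂ) = ((joukStieltjesX Δ ρ T : ℝ) : ℂ))
    {w₀ : ℝ} (hw0 : 0 < w₀) (hw2 : w₀ < 2) : ρ (Ioc w₀ 2) = 0 := by
  have hae : ∀ᵐ c ∂ρ, c ∈ Icc (-2 : ℝ) 2 := by
    filter_upwards [measure_eq_zero_iff_ae_notMem.1 hρ] with c hc
    simpa using hc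
  /- the angle `θ ∈ (0, π/2)` with `2 cos θ = w₀`, and the arc point `ζ = e^{iθ}` -/
  set θ : ℝ := Real.arccos (w₀ / 2) with hθ
  have hcos : Real.cos θ = w₀ / 2 := Real.cos_arccos (by linarith) (by linarith)
  have hθpos : 0 < θ := Real.arccos_pos.2 (by linarith)
  have hθlt : θ < Real.pi / 2 := by rw [hθ, Real.arccos_lt_pi_div_two]; linarith
  have hsin : 0 < Real.sin θ := Real.sin_pos_of_pos_of_lt_pi hθpos (by linarith [Real.pi_pos])
  set ζ : ℂ := exp (θ * I) with hζ
  have hζre : ζ.re = Real.cos θ := exp_ofReal_mul_I_re θ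
  have hζim : ζ.im = Real.sin θ := exp_ofReal_mul_I_im θ
  have hζnorm : ‖ζ‖ = 1 := norm_exp_ofReal_mul_I θ
  have hζ0 : ζ ≠ 0 := by
    intro h; rw [h, norm_zero] at hζnorm; exact zero_ne_one hζnorm
  have hζinv : ζ⁻¹ = exp (((-θ : ℝ) : ℂ) * I) := by
    rw [hζ, ← Complex.exp_neg]; push_cast; ring_nf
  have hζinv_re : (ζ⁻¹).re = Real.cos θ := by rw [hζinv, exp_ofReal_mul_I_re, Real.cos_neg]
  have hζinv_im : (ζ⁻¹).im = -Real.sin θ := by rw [hζinv, exp_ofReal_mul_I_im, Real.sin_neg]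
  have hJζ : ζ + ζ⁻¹ = (w₀ : ℂ) := by
    apply Complex.ext
    · simp only [Complex.add_re, hζre, hζinv_re, Complex.ofReal_re]; linarith
    · simp only [Complex.add_im, hζim, hζinv_im, Complex.ofReal_im]; ring
  have hζmem : ζ ∈ {z : ℂ | 0 < z.re} := by
    show 0 < ζ.re; rw [hζre, hcos]; linarith
  /- the two radial sequences `T n = r_n ζ ∈ D₊`, `T' n = ζ / r_n ∈ D₋`, `r_n ↓ 1` -/
  set r : ℕ → ℝ := fun n => 1 + 1 / ((n : ℝ) + 1) with hr
  have hr1 : ∀ n, 1 < r n := fun n => by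
    have : (0 : ℝ) < 1 / ((n : ℝ) + 1) := by positivity
    simp only [hr]; linarith
  have hr0 : ∀ n, 0 < r n := fun n => by linarith [hr1 n]
  have hr_tendsto : Tendsto r atTop (𝓝 1) := by
    simpa [hr] using tendsto_one_div_add_atTop_nhds_zero_nat.const_add (1 : ℝ)
  set T : ℕ → ℂ := fun n => (r n : ℂ) * ζ with hT
  set T' : ℕ → ℂ := fun n => (((r n)⁻¹ : ℝ) : ℂ) * ζ with hT'
  have hTim : ∀ n, 0 < (T n).im := fun n => by
    simp only [hT, Complex.im_ofReal_mul, hζim]; exact mul_pos (hr0 n) hsin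
  have hT'im : ∀ n, 0 < (T' n).im := fun n => by
    simp only [hT', Complex.im_ofReal_mul, hζim]; exact mul_pos (inv_pos.2 (hr0 n)) hsin
  have hT_outer : ∀ n, T n ∈ {T : ℂ | 1 < ‖T‖ ∧ 0 < T.re} := fun n => by
    constructor
    · simp only [hT, norm_mul, Complex.norm_real, Real.norm_eq_abs, abs_of_pos (hr0 n), hζnorm, mul_one]
      exact hr1 n
    · simp only [hT, Complex.re_ofReal_mul, hζre, hcos]; exact mul_pos (hr0 n) (by linarith)
  have hT'_inner : ∀ n, T' n ∈ {T : ℂ | ‖T‖ < 1 ∧ 0 < T.re} := fun n => by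
    constructor
    · simp only [hT', norm_mul, Complex.norm_real, Real.norm_eq_abs, abs_of_pos (inv_pos.2 (hr0 n)),
        hζnorm, mul_one]
      exact inv_lt_one_of_one_lt₀ (hr1 n)
    · simp only [hT', Complex.re_ofReal_mul, hζre, hcos]
      exact mul_pos (inv_pos.2 (hr0 n)) (by linarith)
  have hT_lim : Tendsto T atTop (𝓝 ζ) := by
    have := ((Complex.continuous_ofReal.tendsto 1).comp hr_tendsto).mul_const ζ
    simpa [hT, Function.comp_def] using this
  have hT'_lim : Tendsto T' atTop (𝓝 ζ) := by
    have hinv : Tendsto (fun n => (r n)⁻¹) atTop (𝓝 1) := by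
      simpa using hr_tendsto.inv₀ one_ne_zero
    have := ((Complex.continuous_ofReal.tendsto 1).comp hinv).mul_const ζ
    simpa [hT', Function.comp_def] using this
  /- the order-`Δ` Stieltjes transform `S`; `F = S∘J` on `D₊` and on `D₋` -/
  set S : ℂ → ℂ := fun w => ∫ c, (w - (c : ℂ)) ^ (-(Δ : ℂ)) ∂ρ with hS
  have hSd : DifferentiableOn ℂ S {w : ℂ | w.im ≠ 0 ∨ 2 < w.re} :=
    differentiableOn_orderStieltjes h0.le ρ hρ
  have hJd : ∀ U : Set ℂ, (∀ z ∈ U, z ≠ 0) → DifferentiableOn ℂ (fun z : ℂ => z + z⁻¹) U := by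
    intro U hU z hz
    have hz0 := hU z hz
    exact (differentiableAt_id.add (differentiableAt_id.inv hz0)).differentiableWithinAt
  have hne_outer : ∀ z ∈ {T : ℂ | 1 < ‖T‖ ∧ 0 < T.re}, z ≠ 0 := by
    rintro z hz rfl; simp at hz
  have hne_inner : ∀ z ∈ {T : ℂ | ‖T‖ < 1 ∧ 0 < T.re}, z ≠ 0 := by
    rintro z hz rfl; simp at hz
  have hSJ_outer : DifferentiableOn ℂ (fun z : ℂ => S (z + z⁻¹)) {T : ℂ | 1 < ‖T‖ ∧ 0 < T.re} :=
    hSd.comp (hJd _ hne_outer) mapsTo_joukowski_outer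
  have hSJ_inner : DifferentiableOn ℂ (fun z : ℂ => S (z + z⁻¹)) {T : ℂ | ‖T‖ < 1 ∧ 0 < T.re} :=
    hSd.comp (hJd _ hne_inner) mapsTo_joukowski_inner
  have hreal : ∀ t : ℝ, 0 < t → t ≠ 1 → F t = S ((t : ℂ) + (t : ℂ)⁻¹) := fun t ht ht1 => by
    rw [hFeq t ht ht1, hS]; exact (S_J_real ρ hρ ht ht1).symm
  have hEq_outer : EqOn F (fun z : ℂ => S (z + z⁻¹)) {T : ℂ | 1 < ‖T‖ ∧ 0 < T.re} :=
    eqOn_of_isPreconnected_of_eqOn_Ioo isOpen_outer isPreconnected_outer one_lt_two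
      (fun t h1t _ => ⟨by simpa [abs_of_pos (show (0:ℝ) < t by linarith)] using h1t,
        by simpa using (show (0:ℝ) < t by linarith)⟩)
      (hF.mono fun z hz => hz.2) hSJ_outer (fun t h1t _ => hreal t (by linarith) (by linarith))
  have hEq_inner : EqOn F (fun z : ℂ => S (z + z⁻¹)) {T : ℂ | ‖T‖ < 1 ∧ 0 < T.re} :=
    eqOn_of_isPreconnected_of_eqOn_Ioo isOpen_inner isPreconnected_inner (a := 1 / 2) (b := 1)
      (by norm_num)
      (fun t hat htb => ⟨by simpa [abs_of_pos (show (0:ℝ) < t by linarith)] using htb,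
        by simpa using (show (0:ℝ) < t by linarith)⟩)
      (hF.mono fun z hz => hz.2) hSJ_inner (fun t hat htb => hreal t (by linarith) (by linarith))
  /- signs: `Im S ≤ 0` on the upper half-plane, `≥ 0` on the lower -/
  have hInt : ∀ w : ℂ, (w.im ≠ 0 ∨ 2 < w.re) →
      Integrable (fun c : ℝ => (w - (c : ℂ)) ^ (-(Δ : ℂ))) ρ := by
    intro w hw
    obtain ⟨hm, hsep⟩ := slit_separation hw
    refine Integrable.mono' (integrable_const ((max |w.im| (w.re - 2) / 2) ^ (-Δ)))
      ((measurable_const.sub measurable_ofReal).pow_const _).aestronglyMeasurable ?_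
    filter_upwards [hae] with c hc
    obtain ⟨hle, -⟩ := hsep w (Metric.mem_ball_self (by positivity)) c hc
    rw [show (-(Δ : ℂ)) = ((-Δ : ℝ) : ℂ) by push_cast; ring, norm_cpow_real]
    exact Real.rpow_le_rpow_of_nonpos (by positivity) hle (by linarith)
  have hImS : ∀ w : ℂ, (w.im ≠ 0 ∨ 2 < w.re) →
      (S w).im = ∫ c, ((w - (c : ℂ)) ^ (-(Δ : ℂ))).im ∂ρ := by
    intro w hw
    have := integral_im (hInt w hw)
    simpa [hS] using this.symm
  have hImS_neg : ∀ w : ℂ, 0 < w.im → (S w).im ≤ 0 := by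
    intro w hw
    rw [hImS w (Or.inl hw.ne')]
    exact integral_nonpos fun c => (im_cpow_neg_neg hw c h0 h1.le).le
  have hImS_pos : ∀ w : ℂ, w.im < 0 → 0 ≤ (S w).im := by
    intro w hw
    rw [hImS w (Or.inl hw.ne)]
    exact integral_nonneg fun c => (im_cpow_neg_pos hw c h0 h1.le).le
  /- continuity of `F` at `ζ`: `Im F(ζ) = 0` and `Im F(T n) → 0` -/
  have hFcont : ContinuousAt F ζ :=
    hF.continuousOn.continuousAt ((isOpen_lt continuous_const Complex.continuous_re).mem_nhds hζmem)
  have hFT : Tendsto (fun n => F (T n)) atTop (𝓝 (F ζ)) := hFcont.tendsto.comp hT_lim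
  have hFT' : Tendsto (fun n => F (T' n)) atTop (𝓝 (F ζ)) := hFcont.tendsto.comp hT'_lim
  have hJT_im : ∀ n, 0 < (T n + (T n)⁻¹).im := fun n => im_add_inv_pos (hT_outer n).1 (hTim n)
  have hJT'_im : ∀ n, (T' n + (T' n)⁻¹).im < 0 := fun n =>
    im_add_inv_neg (hne_inner _ (hT'_inner n)) (hT'_inner n).1 (hT'im n)
  have hle : (F ζ).im ≤ 0 := by
    refine le_of_tendsto ((Complex.continuous_im.tendsto _).comp hFT) (Eventually.of_forall fun n => ?_)
    show (F (T n)).im ≤ 0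
    rw [hEq_outer (hT_outer n)]
    exact hImS_neg _ (hJT_im n)
  have hge : 0 ≤ (F ζ).im := by
    refine ge_of_tendsto ((Complex.continuous_im.tendsto _).comp hFT') (Eventually.of_forall fun n => ?_)
    show 0 ≤ (F (T' n)).im
    rw [hEq_inner (hT'_inner n)]
    exact hImS_pos _ (hJT'_im n)
  have hzero : (F ζ).im = 0 := le_antisymm hle hge
  have hImT : Tendsto (fun n => (F (T n)).im) atTop (𝓝 0) := by
    have := (Complex.continuous_im.tendsto _).comp hFT
    rw [hzero] at this
    exact this
  /- `J(T n) → w₀` within the closed upper half-plane -/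
  have hJT : Tendsto (fun n => T n + (T n)⁻¹) atTop (𝓝[{w : ℂ | 0 ≤ w.im}] (w₀ : ℂ)) := by
    rw [tendsto_nhdsWithin_iff]
    constructor
    · have hJcont : ContinuousAt (fun z : ℂ => z + z⁻¹) ζ :=
        (continuousAt_id.add (continuousAt_inv₀ hζ0))
      have := hJcont.tendsto.comp hT_lim
      rw [hJζ] at this
      simpa [Function.comp_def] using this
    · exact Eventually.of_forall fun n => (hJT_im n).le
  /- Fatou -/
  set g : ℕ → ℝ → ENNReal := fun n c =>
    ENNReal.ofReal (-(((T n + (T n)⁻¹) - (c : ℂ)) ^ (-(Δ : ℂ))).im) with hg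
  have hg_meas : ∀ n, Measurable (g n) := fun n =>
    (Complex.measurable_im.comp ((measurable_const.sub measurable_ofReal).pow_const _)).neg.ennreal_ofReal
  have hlint : ∀ n, ∫⁻ c, g n c ∂ρ = ENNReal.ofReal (-(F (T n)).im) := by
    intro n
    have hint_n := hInt _ (Or.inl (hJT_im n).ne')
    rw [hEq_outer (hT_outer n)]
    show ∫⁻ c, g n c ∂ρ = ENNReal.ofReal (-(S (T n + (T n)⁻¹)).im)
    have hint2 : Integrable (fun c : ℝ => -((T n + (T n)⁻¹ - (c : ℂ)) ^ (-(Δ : ℂ))).im) ρ := by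
      have := hint_n.im.neg
      refine this.congr (ae_of_all _ fun c => ?_)
      simp
    rw [hImS _ (Or.inl (hJT_im n).ne'), ← integral_neg,
      ofReal_integral_eq_lintegral_ofReal hint2 (ae_of_all _ fun c => ?_)]
    have := im_cpow_neg_neg (hJT_im n) c h0 h1.le
    simp only [Pi.zero_apply]
    linarith
  have hlim0 : Tendsto (fun n => ∫⁻ c, g n c ∂ρ) atTop (𝓝 0) := by
    simp_rw [hlint]
    have := ENNReal.tendsto_ofReal hImT.neg
    simpa using this
  have hfatou : ∫⁻ c, liminf (fun n => g n c) atTop ∂ρ ≤ liminf (fun n => ∫⁻ c, g n c ∂ρ) atTop :=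
    lintegral_liminf_le hg_meas
  have hint0 : ∫⁻ c, liminf (fun n => g n c) atTop ∂ρ = 0 :=
    le_antisymm (hfatou.trans hlim0.liminf_eq.le) bot_le
  have hae0 : ∀ᵐ c ∂ρ, liminf (fun n => g n c) atTop = 0 :=
    (lintegral_eq_zero_iff (Measurable.liminf hg_meas)).1 hint0
  have hposlim : ∀ c : ℝ, w₀ < c →
      liminf (fun n => g n c) atTop = ENNReal.ofReal ((c - w₀) ^ (-Δ) * Real.sin (Real.pi * Δ)) := by
    intro c hc
    apply Tendsto.liminf_eq
    have h2 := (tendsto_cpow_neg_im_nhdsWithin_im_nonneg hc Δ).comp hJT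
    have h3 := ENNReal.tendsto_ofReal h2.neg
    rw [neg_mul, neg_neg] at h3
    exact h3
  have hnot : ∀ᵐ c ∂ρ, c ∉ Ioc w₀ 2 := by
    filter_upwards [hae0] with c hc hmem
    rw [hposlim c hmem.1] at hc
    have hpos : 0 < (c - w₀) ^ (-Δ) * Real.sin (Real.pi * Δ) := by
      have := lever_boundary_im_neg hmem.1 h0 h1; linarith
    exact absurd hc (ENNReal.ofReal_pos.2 hpos).ne'
  exact measure_eq_zero_iff_ae_notMem.2 hnot

open Complex in
/-- **The x-side lever for `0 < Δ < 1`** (= stub `stub_sliceNoMass_lt_one` of the line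
`tilted-lightcone-jump-positivity`, up to the verbatim restatement `SliceNoMassX`): an order-`Δ` Stieltjes
transform of a finite positive measure on `[-2,2]` whose Joukowski pull-back agrees on `(0,1) ∪ (1,∞)`
with a function holomorphic on the right half-plane charges nothing in `(0,2)`. Proof: `F = S∘J` on `D±`
(identity theorem), `Im F(e^{iθ}) = 0` by the two one-sided signs, Fatou along `r ↓ 1` with the one-signed
boundary values `(c - 2cos θ)^{-Δ} sin(πΔ) > 0` on `c > 2cos θ`. -/
theorem sliceNoMassX_of_lt_one {Δ : ℝ} (h0 : 0 < Δ) (h1 : Δ < 1) : SliceNoMassX Δ := by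
  intro ρ hfin hρ hF
  obtain ⟨F, hF, hFeq⟩ := hF
  have key : ∀ n : ℕ, ρ (Ioc (2 / ((n : ℝ) + 2)) 2) = 0 := fun n =>
    noMass_Ioc h0 h1 ρ hρ F hF hFeq (by positivity) (by
      rw [div_lt_iff₀ (by positivity)]; nlinarith)
  have hcover : Ioo (0 : ℝ) 2 ⊆ ⋃ n : ℕ, Ioc (2 / ((n : ℝ) + 2)) 2 := by
    intro x hx
    obtain ⟨n, hn⟩ := exists_nat_gt (2 / x)
    refine mem_iUnion.2 ⟨n, ?_, hx.2.le⟩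
    rw [div_lt_iff₀ (by positivity)]
    have h2 : 2 < (n : ℝ) * x := by
      have := (div_lt_iff₀ hx.1).1 hn; linarith
    nlinarith [hx.1]
  exact measure_mono_null hcover (measure_iUnion_null key)

end Cycle3

end Summit.CriticalPhenomena.Ising3DConformalLimit.Cruxes.GSMRigidity.Disproof
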